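/-
Copyright (c) 2026 the pub-hodgecm-mathlib formalisation cell (harness21).  Prover seat hodgecm-mathlib-K2E3-p12 (g8), Track B ∕ K2-LIT, h413 = `stmt-HodgeConjecture-24833`,
line `K2_E1_TraceFormulaBeta`, 5Res ROADCARD «ENDGAME BY FAMILIES» (K2E1-plan (g7), (154)) file C1 «f3-χ» (deal (142)), part H-c: the SELF-DUAL TWO-TERM inner product formula (SD) for a
twisted pseudo-Eisenstein family `Θ_χ`, `χʷ = χ` — the `(χ,τ)`-twin of ★ Final p859681 (★ H-a split ∘ ★ C ∘ Fubini `(0,∞) × K_U` ∘ ★ A Parseval I∕II with the section-valued scalar `I_{φ′}(z,k)`).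
-/
import Summits.HodgeConjecture.HodgeConjecture.Theorems.K2E1ChiPseudoEisensteinIdeleSplitCMTwo       -- ★ H-a (this seat); transitively ★ W-b, ★ D0-χ, ★ C, ★ A, ★ Final §1
import HarnessLib

/-!
# C1 «f3-χ», part H-c — `K2E1ChiPseudoEisensteinSelfDualCMTwo`: (SD) for a UNITARY SELF-DUAL `χ` (`χʷ = χ`) and `χ`-sections `φ, φ′`:
# `⟨θ_{f,φ}, θ_{f′,φ′}⟩_X = C·( (2π)⁻¹∫ f̃(z)·conj f̃′(z̄−1) dy·⟪φ,φ′⟫_K + (ν𝓕)⁻¹ • ∫_{K_U} φ(k)·(2π)⁻¹∫ f̃(z)·conj f̃′(z̄)·conj I_{φ′}(z̄, k) dy dμ_K )`, `z = σ₀ + iy`, `σ₀ > 1`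

Track B ∕ K2-LIT, crux h413 = `stmt-HodgeConjecture-24833`, route of record `HCCMUnconditional`; cell `hodgecm-mathlib`, squad K2, ENGINE E1.  THEOREMS ONLY (no `def`, no `instance`,
no `notation`, no named-fact hypothesis, no `sorry`); lane `--supports stmt-HodgeConjecture-24833 --as helper` (count-neutral).
THE MATHEMATICS ([MoeglinWaldspurger1995, II.2.1]; [Rogawski1990, §7.3]; [GelbartRogawski1991, §3.1]; [Titchmarsh1948, Thm 71–72]; ROADCARD (154) §1 (SD)).  ★ H-a: `⟨θ,θ′⟩ = C(∫G₁ + ∫G₂)`.  For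
`χ` unitary and self-dual both characters `χ·conj χ` and `χ·conj χʷ` are `|χ|² = 1`, so BOTH terms are radial: `G₁(x) = ‖x‖⁻¹•φ₁(‖x‖)`, `φ₁(r) = f conj f′(r)·⟪φ,φ′⟫_K` — ★ C then ★ A Parseval I
(as in ★ Final ∕ ★ H-b (OD)); `G₂(x) = ‖x‖⁻¹•φ₂(‖x‖)`, `φ₂(r) = f(r)·∫_{K_U} φ(k)·conj((ν𝓕)⁻¹•(2π)⁻¹∫ f̃′(z)·r^{1−z}·I_{φ′}(z,k) dy) dμ_K` (`r·(r⁻¹)^z = r^{1−z}`) — ★ C gives `V•∫_0^∞ φ₂(r)r⁻² dr`,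
Fubini on `(0,∞) × K_U` (integrand Borel by the parametric-integral tower of ★ W-b∕H-a, dominated by `|f(r)|r^{−1−σ₀}·const` through the uniform Godement bound ★ H-a §1) moves `∫_{K_U}` outside, and
★ A Parseval II with the scalar `c(z) = I_{φ′}(z,k)` (continuous in `y` by dominated convergence §1, bounded by ★ H-a §1) evaluates the inner `dr`-integral for each `k`:
`∫_0^∞ f(r)r⁻² conj((2π)⁻¹∫ f̃′(z)I(z,k)r^{1−z} dy) dr = (2π)⁻¹∫ f̃(z)·conj f̃′(z̄)·conj I(z̄,k) dy`.  (`conj I_{φ′}(z̄,k) = I_{conj φ′}(z,k)` is the intertwining integral of the `χ⁻¹`-section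
`conj φ′`; the `K_U`-pairing `∫ φ(k)·conj I_{φ′}(z̄,k) dμ_K` is the «`⟪M(z)φ, φ′⟫`» of ROADCARD (154) §1 in section-valued form.)
* §1 `continuous_integral_flatSectionU_weylLongU_vertical_cm_two`, `ofReal_mul_ofReal_inv_cpow`.  * §2 `measurable_w0Integrand_cm_two`, `norm_w0Integrand_le_cm_two`, `integrable_w0_prod_cm_two`,
  `setIntegral_w0_inner_eq_cm_two`, `setIntegral_w0_radial_eq_cm_two` (the `w = w₀` radial integral).  * §3 **`chiPseudoEisenstein_inner_product_selfDual_cm_two`** (SD).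
HONEST LABEL: HC_CM is proved only modulo the 7 printed citations (2 remaining named inputs: hLiu418 = `stmt-HodgeConjecture-24832`, h413 = `stmt-HodgeConjecture-24833`) until rung 0
closes; this file asserts no named fact, closes no socket; count-neutral; letter-free.

## References
* [MoeglinWaldspurger1995] C. Mœglin, J.-L. Waldspurger, *Spectral decomposition and Eisenstein series* (1995), II.1.5, II.2.1.
* [Rogawski1990] J. D. Rogawski, *Automorphic Representations of Unitary Groups in Three Variables* (1990), §7.3 pp. 96–98.
* [GelbartRogawski1991] S. Gelbart, J. Rogawski, *L-functions and Fourier–Jacobi coefficients for the unitary group U(3)*, Invent. Math. 105 (1991), §3.1.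
* [Titchmarsh1948] E. C. Titchmarsh, *Introduction to the Theory of Fourier Integrals* (1948), Thm 71–72.
* [Garrett2018] P. Garrett, *Modern Analysis of Automorphic Forms by Example* (2018), §2.8.
-/

set_option autoImplicit false
set_option linter.dupNamespace false  -- the mandated namespace repeats the summit's segment (`HodgeConjecture.HodgeConjecture`)

noncomputable section

open MeasureTheory Measure Set Filter Topology Complex NumberField IsDedekindDomain MulAction
open scoped Real NNReal ENNReal ComplexConjugate Pointwise
open Literature.MeasureTheory.Group Literature.NumberTheory
open Literature.NumberTheory.Automorphic Literature.NumberTheory.Automorphic.UnitaryGroup AdelicGroupData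
open Literature.NumberTheory.GaloisRepresentations (HeckeCharacter ideleGroup)
open Summit.HodgeConjecture.HodgeConjecture.Cruxes.H413.K2E1BorelEisensteinU
open Summit.HodgeConjecture.HodgeConjecture.Cruxes.H413.K2E1CharacterEisensteinU2Defs
open Summit.HodgeConjecture.HodgeConjecture.Cruxes.H413.K2E1MellinPaleyWienerHalfLine (setIntegral_mul_conj_mul_cpow_eq setIntegral_mul_cpow_mul_conj_integral_eq differentiable_mellin integrable_ofReal_cpow_mul)
open Summit.HodgeConjecture.HodgeConjecture.Cruxes.H413.K2E1MaassSelbergBracketsThree (measurable_flatSectionU)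
open Summit.HodgeConjecture.HodgeConjecture.Cruxes.H413.K2E1IdeleClassRadialIntegralCM (setIntegral_inv_ideleNorm_smul_comp_eq)
open Summit.HodgeConjecture.HodgeConjecture.Cruxes.H413.K2E1PseudoEisensteinRadialCMTwo (exists_one_le_forall_eq_zero)
open Summit.HodgeConjecture.HodgeConjecture.Cruxes.H413.K2E1PseudoEisensteinInnerProductCMTwoFinal (continuous_and_integrable_norm_mellin_neg)
open Summit.HodgeConjecture.HodgeConjecture.Cruxes.H413.K2E1ChiPseudoEisensteinIdeleSplitCMTwo (chiPseudoEisenstein_inner_product_eq_sum_setIntegral_ideleClass_cm_two norm_reflectChar_apply_of_isUnitary norm_integral_flatSectionU_weylLongU_maximalCompact_le_cm_two)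
open Summit.HodgeConjecture.HodgeConjecture.Cruxes.H413.K2E1IntertwinedCoeffContinuousCMTwo (integrable_borelHeight_weylLongU_mul_rpow_cm_two)
open Summit.HodgeConjecture.HodgeConjecture.Cruxes.H413.K2E1UnipotentHaarNormalisationU2 (isInvInvariant_of_isHaarMeasure_two)
open Summit.HodgeConjecture.HodgeConjecture.Cruxes.H413.K2E1SphericalIntertwiningMellinCMTwo (sigmaFinite_haar_adelicUnipotent_cm_two)

namespace Summit.HodgeConjecture.HodgeConjecture.Cruxes.H413.K2E1ChiPseudoEisensteinSelfDualCMTwo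

/-! ## §1 Two inputs: `y ↦ I_{φ′}(σ₀+iy, g)` is continuous; `r·(r⁻¹)^z = r^{1−z}` -/

/-- `r·(r⁻¹)^z = r^{1−z}` for `r > 0` (real base). [folklore] -/
theorem ofReal_mul_ofReal_inv_cpow {r : ℝ} (hr : 0 < r) (z : ℂ) : ((r : ℝ) : ℂ) * (((r⁻¹ : ℝ)) : ℂ) ^ z = ((r : ℝ) : ℂ) ^ (1 - z) := by
  have hr0 : ((r : ℝ) : ℂ) ≠ 0 := by exact_mod_cast hr.ne'
  rw [Complex.ofReal_inv, Complex.inv_cpow _ _ (by rw [Complex.arg_ofReal_of_nonneg hr.le]; exact Real.pi_pos.ne), ← Complex.cpow_neg, sub_eq_add_neg,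
    Complex.cpow_add _ _ hr0, Complex.cpow_one]

variable (L : Type) [Field L] [NumberField L] [IsCMField L]
variable [MeasurableSpace (quasiSplit (↥(maximalRealSubfield L)) L (IsCMField.complexConj L) 2).Adelic] [BorelSpace (quasiSplit (↥(maximalRealSubfield L)) L (IsCMField.complexConj L) 2).Adelic]

/-- **`y ↦ I_{φ′}(σ₀+iy, g)` IS CONTINUOUS** (`σ₀ > 1`, `φ′` continuous bounded): dominated convergence with the Godement majorant `C_{φ′}·H(w₀ v g)^{σ₀}` (★ CM rank-one integrability).
[cite: MoeglinWaldspurger1995, II.1.5] [cite: Garrett2018, §2.8] -/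
theorem continuous_integral_flatSectionU_weylLongU_vertical_cm_two (ν : Measure ↥(adelicUnipotent (↥(maximalRealSubfield L)) L (IsCMField.complexConj L) 2)) [ν.IsHaarMeasure]
    {𝓕 : Set ↥(adelicUnipotent (↥(maximalRealSubfield L)) L (IsCMField.complexConj L) 2)} (h𝓕N : IsFundamentalDomain ↥(rationalUnipotent (↥(maximalRealSubfield L)) L (IsCMField.complexConj L) 2) 𝓕 ν) (h𝓕c : IsCompact (closure 𝓕))
    {φ' : (quasiSplit (↥(maximalRealSubfield L)) L (IsCMField.complexConj L) 2).Adelic → ℂ} (hφ'c : Continuous φ') {Cφ' : ℝ} (hφ'C : ∀ x, ‖φ' x‖ ≤ Cφ') {σ₀ : ℝ} (hσ₀ : 1 < σ₀) (g : (quasiSplit (↥(maximalRealSubfield L)) L (IsCMField.complexConj L) 2).Adelic) :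
    Continuous fun y : ℝ => ∫ v : ↥(adelicUnipotent (↥(maximalRealSubfield L)) L (IsCMField.complexConj L) 2), flatSectionU φ' ((σ₀ : ℂ) + y * I) (((quasiSplit (↥(maximalRealSubfield L)) L (IsCMField.complexConj L) 2).toAdelic (weylLongU ((IsCMField.complexConj L : L ≃ₐ[↥(maximalRealSubfield L)] L) : L →+* L) (rfl : (StdForm.antidiagonal 2).over L = (StdForm.antidiagonal 2).over L))) * ((v : (quasiSplit (↥(maximalRealSubfield L)) L (IsCMField.complexConj L) 2).Adelic) * g)) ∂ν := by
  haveI := locallyCompactSpace_adeleRing' L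
  haveI : ν.IsInvInvariant := isInvInvariant_of_isHaarMeasure_two ν
  have hI := integrable_borelHeight_weylLongU_mul_rpow_cm_two L ν h𝓕N h𝓕c hσ₀ g
  have hmv : Continuous fun v : ↥(adelicUnipotent (↥(maximalRealSubfield L)) L (IsCMField.complexConj L) 2) => ((quasiSplit (↥(maximalRealSubfield L)) L (IsCMField.complexConj L) 2).toAdelic (weylLongU ((IsCMField.complexConj L : L ≃ₐ[↥(maximalRealSubfield L)] L) : L →+* L) (rfl : (StdForm.antidiagonal 2).over L = (StdForm.antidiagonal 2).over L))) * ((v : (quasiSplit (↥(maximalRealSubfield L)) L (IsCMField.complexConj L) 2).Adelic) * g) := continuous_const.mul (continuous_subtype_val.mul continuous_const)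
  refine continuous_of_dominated (fun y => ((measurable_flatSectionU hφ'c.measurable _).comp hmv.measurable).aestronglyMeasurable)
    (fun y => ae_of_all _ fun v => ?_) (hI.const_mul Cφ') (ae_of_all _ fun v => ?_)
  · have hp : (0 : ℝ) < (borelHeight (((quasiSplit (↥(maximalRealSubfield L)) L (IsCMField.complexConj L) 2).toAdelic (weylLongU ((IsCMField.complexConj L : L ≃ₐ[↥(maximalRealSubfield L)] L) : L →+* L) (rfl : (StdForm.antidiagonal 2).over L = (StdForm.antidiagonal 2).over L))) * ((v : (quasiSplit (↥(maximalRealSubfield L)) L (IsCMField.complexConj L) 2).Adelic) * g)) : ℝ) := by exact_mod_cast borelHeight_pos _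
    rw [flatSectionU_apply, norm_mul, Complex.norm_cpow_eq_rpow_re_of_pos hp]
    simp only [Complex.add_re, Complex.ofReal_re, Complex.mul_re, Complex.I_re, Complex.I_im, Complex.ofReal_im, mul_zero, zero_mul, sub_self, add_zero]
    exact mul_le_mul_of_nonneg_right (hφ'C _) (Real.rpow_nonneg (NNReal.coe_nonneg _) _)
  · simp only [flatSectionU_apply]
    have hne : (((borelHeight (((quasiSplit (↥(maximalRealSubfield L)) L (IsCMField.complexConj L) 2).toAdelic (weylLongU ((IsCMField.complexConj L : L ≃ₐ[↥(maximalRealSubfield L)] L) : L →+* L) (rfl : (StdForm.antidiagonal 2).over L = (StdForm.antidiagonal 2).over L))) * ((v : (quasiSplit (↥(maximalRealSubfield L)) L (IsCMField.complexConj L) 2).Adelic) * g)) : ℝ) : ℂ)) ≠ 0 := by exact_mod_cast (borelHeight_pos _).ne'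
    exact continuous_const.mul (Continuous.const_cpow (by fun_prop) (Or.inl hne))

/-! ## §2 The `w = w₀` radial integral: measurability, domination, Fubini on `(0,∞) × K_U`, Parseval II per `k` (each its own declaration — heartbeat budget) -/

/-- The `K_U`-integrand `T₂(r,k) = φ(k)·conj((ν𝓕)⁻¹•(2π)⁻¹∫ f̃′(z)·(r(r⁻¹)^z)·I_{φ′}(z,k) dy)` of the `w = w₀` term is jointly Borel in `(r,k)` (parametric-integral tower: `(k,y,v) ↦ (φ′H^z)(w₀vk)`
continuous ⇒ `I` Borel in `(k,y)` ⇒ the `y`-integrand Borel ⇒ `∫ dy` Borel, Mathlib `StronglyMeasurable.integral_prod_right'`). [cite: MoeglinWaldspurger1995, II.1.7] -/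
theorem measurable_w0Integrand_cm_two (ν : Measure ↥(adelicUnipotent (↥(maximalRealSubfield L)) L (IsCMField.complexConj L) 2)) [ν.IsHaarMeasure] (𝓕 : Set ↥(adelicUnipotent (↥(maximalRealSubfield L)) L (IsCMField.complexConj L) 2))
    {φ φ' : (quasiSplit (↥(maximalRealSubfield L)) L (IsCMField.complexConj L) 2).Adelic → ℂ} (hφc : Continuous φ) (hφ'c : Continuous φ') {f' : ℝ → ℂ} (hf' : ContDiff ℝ 2 f') (hf's : HasCompactSupport f') (hf'0 : tsupport f' ⊆ Ioi 0) (σ₀ : ℝ) :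
    Measurable fun p : ℝ × ((standardMaximalCompactGL 2 L).comap (adelicVal (↥(maximalRealSubfield L)) L (IsCMField.complexConj L) 2 ((StdForm.antidiagonal 2).over L)) : Subgroup (quasiSplit (↥(maximalRealSubfield L)) L (IsCMField.complexConj L) 2).Adelic) => φ (p.2 : (quasiSplit (↥(maximalRealSubfield L)) L (IsCMField.complexConj L) 2).Adelic) * conj (((ν 𝓕).toReal⁻¹ : ℝ) • ((((2 * π)⁻¹ : ℝ) : ℂ) * ∫ y : ℝ, mellin f' (-((σ₀ : ℂ) + y * I)) * ((((p.1 : ℝ) : ℂ) * (((p.1)⁻¹ : ℝ) : ℂ) ^ ((σ₀ : ℂ) + y * I)) * ∫ v : ↥(adelicUnipotent (↥(maximalRealSubfield L)) L (IsCMField.complexConj L) 2), flatSectionU φ' ((σ₀ : ℂ) + y * I) (((quasiSplit (↥(maximalRealSubfield L)) L (IsCMField.complexConj L) 2).toAdelic (weylLongU ((IsCMField.complexConj L : L ≃ₐ[↥(maximalRealSubfield L)] L) : L →+* L) (rfl : (StdForm.antidiagonal 2).over L = (StdForm.antidiagonal 2).over L))) * ((v : (quasiSplit (↥(maximalRealSubfield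 L)) L (IsCMField.complexConj L) 2).Adelic) * (p.2 : (quasiSplit (↥(maximalRealSubfield L)) L (IsCMField.complexConj L) 2).Adelic))) ∂ν))) := by
  haveI := t2Space_adeleRing_of_numberField L
  haveI := locallyCompactSpace_adeleRing' L
  haveI := secondCountableTopology_adeleRing L
  haveI : SecondCountableTopology (quasiSplit (↥(maximalRealSubfield L)) L (IsCMField.complexConj L) 2).Adelic := inferInstanceAs (SecondCountableTopology (adelic (↥(maximalRealSubfield L)) L (IsCMField.complexConj L) 2 ((StdForm.antidiagonal 2).over L)))
  haveI := sigmaFinite_haar_adelicUnipotent_cm_two L ν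
  have hHc : Continuous fun g : (quasiSplit (↥(maximalRealSubfield L)) L (IsCMField.complexConj L) 2).Adelic => (borelHeight g : ℝ) := NNReal.continuous_coe.comp continuous_borelHeight
  have hmW : Continuous fun q : (((standardMaximalCompactGL 2 L).comap (adelicVal (↥(maximalRealSubfield L)) L (IsCMField.complexConj L) 2 ((StdForm.antidiagonal 2).over L)) : Subgroup (quasiSplit (↥(maximalRealSubfield L)) L (IsCMField.complexConj L) 2).Adelic) × ℝ) × ↥(adelicUnipotent (↥(maximalRealSubfield L)) L (IsCMField.complexConj L) 2) => ((quasiSplit (↥(maximalRealSubfield L)) L (IsCMField.complexConj L) 2).toAdelic (weylLongU ((IsCMField.complexConj L : L ≃ₐ[↥(maximalRealSubfield L)] L) : L →+* L) (rfl : (StdForm.antidiagonal 2).over L = (StdForm.antidiagonal 2).over L))) * ((q.2 : (quasiSplit (↥(maximalRealSubfield L)) L (IsCMField.complexConj L) 2).Adelic) * (q.1.1 : (quasiSplit (↥(maximalRealSubfield L)) L (IsCMField.complexConj L) 2).Adelic)) :=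
    continuous_const.mul ((continuous_subtype_val.comp continuous_snd).mul (continuous_subtype_val.comp (continuous_fst.comp continuous_fst)))
  have hR : Measurable fun q : (((standardMaximalCompactGL 2 L).comap (adelicVal (↥(maximalRealSubfield L)) L (IsCMField.complexConj L) 2 ((StdForm.antidiagonal 2).over L)) : Subgroup (quasiSplit (↥(maximalRealSubfield L)) L (IsCMField.complexConj L) 2).Adelic) × ℝ) × ↥(adelicUnipotent (↥(maximalRealSubfield L)) L (IsCMField.complexConj L) 2) => flatSectionU φ' ((σ₀ : ℂ) + q.1.2 * I) (((quasiSplit (↥(maximalRealSubfield L)) L (IsCMField.complexConj L) 2).toAdelic (weylLongU ((IsCMField.complexConj L : L ≃ₐ[↥(maximalRealSubfield L)] L) : L →+* L) (rfl : (StdForm.antidiagonal 2).over L = (StdForm.antidiagonal 2).over L))) * ((q.2 : (quasiSplit (↥(maximalRealSubfield L)) L (IsCMField.complexConj L) 2).Adelic) * (q.1.1 : (quasiSplit (↥(maximalRealSubfield L)) L (IsCMField.complexConj L) 2).Adelic))) := by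
    simp only [flatSectionU_apply]
    exact (hφ'c.measurable.comp hmW.measurable).mul (((continuous_ofReal.comp hHc).measurable.comp hmW.measurable).pow (by fun_prop))
  set Iφ' : ((standardMaximalCompactGL 2 L).comap (adelicVal (↥(maximalRealSubfield L)) L (IsCMField.complexConj L) 2 ((StdForm.antidiagonal 2).over L)) : Subgroup (quasiSplit (↥(maximalRealSubfield L)) L (IsCMField.complexConj L) 2).Adelic) × ℝ → ℂ := fun p => ∫ v : ↥(adelicUnipotent (↥(maximalRealSubfield L)) L (IsCMField.complexConj L) 2), flatSectionU φ' ((σ₀ : ℂ) + p.2 * I) (((quasiSplit (↥(maximalRealSubfield L)) L (IsCMField.complexConj L) 2).toAdelic (weylLongU ((IsCMField.complexConj L : L ≃ₐ[↥(maximalRealSubfield L)] L) : L →+* L) (rfl : (StdForm.antidiagonal 2).over L = (StdForm.antidiagonal 2).over L))) * ((v : (quasiSplit (↥(maximalRealSubfield L)) L (IsCMField.complexConj L) 2).Adelic) * (p.1 : (quasiSplit (↥(maximalRealSubfield L)) L (IsCMField.complexConj L) 2).Adelic))) ∂ν with hIφ'def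
  have hIφ'm : Measurable Iφ' := (hR.stronglyMeasurable.integral_prod_right' (ν := ν)).measurable
  have hmel : Continuous fun y : ℝ => mellin f' (-((σ₀ : ℂ) + y * I)) := (differentiable_mellin hf'.continuous hf's hf'0).continuous.comp (by fun_prop : Continuous fun y : ℝ => -((σ₀ : ℂ) + y * I))
  set S' : (ℝ × ((standardMaximalCompactGL 2 L).comap (adelicVal (↥(maximalRealSubfield L)) L (IsCMField.complexConj L) 2 ((StdForm.antidiagonal 2).over L)) : Subgroup (quasiSplit (↥(maximalRealSubfield L)) L (IsCMField.complexConj L) 2).Adelic)) × ℝ → ℂ := fun q => mellin f' (-((σ₀ : ℂ) + q.2 * I)) * ((((q.1.1 : ℝ) : ℂ) * (((q.1.1)⁻¹ : ℝ) : ℂ) ^ ((σ₀ : ℂ) + q.2 * I)) * Iφ' (q.1.2, q.2)) with hS'def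
  have hS1 : Measurable fun q : (ℝ × ((standardMaximalCompactGL 2 L).comap (adelicVal (↥(maximalRealSubfield L)) L (IsCMField.complexConj L) 2 ((StdForm.antidiagonal 2).over L)) : Subgroup (quasiSplit (↥(maximalRealSubfield L)) L (IsCMField.complexConj L) 2).Adelic)) × ℝ => mellin f' (-((σ₀ : ℂ) + q.2 * I)) := hmel.measurable.comp measurable_snd
  have hS2 : Measurable fun q : (ℝ × ((standardMaximalCompactGL 2 L).comap (adelicVal (↥(maximalRealSubfield L)) L (IsCMField.complexConj L) 2 ((StdForm.antidiagonal 2).over L)) : Subgroup (quasiSplit (↥(maximalRealSubfield L)) L (IsCMField.complexConj L) 2).Adelic)) × ℝ => ((q.1.1 : ℝ) : ℂ) * (((q.1.1)⁻¹ : ℝ) : ℂ) ^ ((σ₀ : ℂ) + q.2 * I) :=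
    (continuous_ofReal.measurable.comp (measurable_fst.comp measurable_fst)).mul
      ((continuous_ofReal.measurable.comp (measurable_inv.comp (measurable_fst.comp measurable_fst))).pow (by fun_prop))
  have hS3 : Measurable fun q : (ℝ × ((standardMaximalCompactGL 2 L).comap (adelicVal (↥(maximalRealSubfield L)) L (IsCMField.complexConj L) 2 ((StdForm.antidiagonal 2).over L)) : Subgroup (quasiSplit (↥(maximalRealSubfield L)) L (IsCMField.complexConj L) 2).Adelic)) × ℝ => Iφ' (q.1.2, q.2) := hIφ'm.comp ((measurable_snd.comp measurable_fst).prodMk measurable_snd)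
  have hS'm : Measurable S' := hS1.mul (hS2.mul hS3)
  set Y' : ℝ × ((standardMaximalCompactGL 2 L).comap (adelicVal (↥(maximalRealSubfield L)) L (IsCMField.complexConj L) 2 ((StdForm.antidiagonal 2).over L)) : Subgroup (quasiSplit (↥(maximalRealSubfield L)) L (IsCMField.complexConj L) 2).Adelic) → ℂ := fun p => ∫ y : ℝ, S' (p, y) with hY'def
  have hY'm : Measurable Y' := (hS'm.stronglyMeasurable.integral_prod_right' (ν := (volume : Measure ℝ))).measurable
  have hsm : Measurable fun p : ℝ × ((standardMaximalCompactGL 2 L).comap (adelicVal (↥(maximalRealSubfield L)) L (IsCMField.complexConj L) 2 ((StdForm.antidiagonal 2).over L)) : Subgroup (quasiSplit (↥(maximalRealSubfield L)) L (IsCMField.complexConj L) 2).Adelic) => ((ν 𝓕).toReal⁻¹ : ℝ) • ((((2 * π)⁻¹ : ℝ) : ℂ) * Y' p) := (measurable_const.mul hY'm).const_smul ((ν 𝓕).toReal⁻¹ : ℝ)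
  set T2' : ℝ × ((standardMaximalCompactGL 2 L).comap (adelicVal (↥(maximalRealSubfield L)) L (IsCMField.complexConj L) 2 ((StdForm.antidiagonal 2).over L)) : Subgroup (quasiSplit (↥(maximalRealSubfield L)) L (IsCMField.complexConj L) 2).Adelic) → ℂ := fun p => φ (p.2 : (quasiSplit (↥(maximalRealSubfield L)) L (IsCMField.complexConj L) 2).Adelic) * conj (((ν 𝓕).toReal⁻¹ : ℝ) • ((((2 * π)⁻¹ : ℝ) : ℂ) * Y' p)) with hT2'def
  have hT2'm : Measurable T2' := (hφc.measurable.comp (measurable_subtype_coe.comp measurable_snd)).mul (continuous_conj.measurable.comp hsm)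
  exact hT2'm

/-- **Uniform bounds**: `‖Y(r,k)‖ ≤ M_{f′}·(r·(r⁻¹)^{σ₀}·(C_{φ′}·c₀))` and hence `‖T₂(r,k)‖ ≤ C_φ·|(ν𝓕)⁻¹|·(2π)⁻¹·M_{f′}·r(r⁻¹)^{σ₀}·C_{φ′}c₀` for `r > 0` (`M_{f′} = ∫|f̃′(z)|dy` ★ A, `c₀ = ∫H(w₀v)^{σ₀}dν`,
uniform Godement bound ★ H-a §1). [cite: MoeglinWaldspurger1995, II.1.5] [cite: Titchmarsh1948, Thm 71] -/
theorem norm_w0Integrand_le_cm_two (ν : Measure ↥(adelicUnipotent (↥(maximalRealSubfield L)) L (IsCMField.complexConj L) 2)) [ν.IsHaarMeasure] {𝓕 : Set ↥(adelicUnipotent (↥(maximalRealSubfield L)) L (IsCMField.complexConj L) 2)}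
    (h𝓕N : IsFundamentalDomain ↥(rationalUnipotent (↥(maximalRealSubfield L)) L (IsCMField.complexConj L) 2) 𝓕 ν) (h𝓕c : IsCompact (closure 𝓕))
    {φ φ' : (quasiSplit (↥(maximalRealSubfield L)) L (IsCMField.complexConj L) 2).Adelic → ℂ} {Cφ : ℝ} (hφC : ∀ x, ‖φ x‖ ≤ Cφ) {Cφ' : ℝ} (hφ'C : ∀ x, ‖φ' x‖ ≤ Cφ') {f' : ℝ → ℂ} (hf' : ContDiff ℝ 2 f') (hf's : HasCompactSupport f') (hf'0 : tsupport f' ⊆ Ioi 0) {σ₀ : ℝ} (hσ₀ : 1 < σ₀)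
    {r : ℝ} (hr : 0 < r) (k : ((standardMaximalCompactGL 2 L).comap (adelicVal (↥(maximalRealSubfield L)) L (IsCMField.complexConj L) 2 ((StdForm.antidiagonal 2).over L)) : Subgroup (quasiSplit (↥(maximalRealSubfield L)) L (IsCMField.complexConj L) 2).Adelic)) :
    ‖φ (k : (quasiSplit (↥(maximalRealSubfield L)) L (IsCMField.complexConj L) 2).Adelic) * conj (((ν 𝓕).toReal⁻¹ : ℝ) • ((((2 * π)⁻¹ : ℝ) : ℂ) * ∫ y : ℝ, mellin f' (-((σ₀ : ℂ) + y * I)) * ((((r : ℝ) : ℂ) * (((r)⁻¹ : ℝ) : ℂ) ^ ((σ₀ : ℂ) + y * I)) * ∫ v : ↥(adelicUnipotent (↥(maximalRealSubfield L)) L (IsCMField.complexConj L) 2), flatSectionU φ' ((σ₀ : ℂ) + y * I) (((quasiSplit (↥(maximalRealSubfield L)) L (IsCMField.complexConj L) 2).toAdelic (weylLongU ((IsCMField.complexConj L : L ≃ₐ[↥(maximalRealSubfield L)] L) : L →+* L) (rfl : (StdForm.antidiagonal 2).over L = (StdForm.antidiagonal 2).over L))) * ((v : (quasiSplit (↥(maximalRealSubfield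 L)) L (IsCMField.complexConj L) 2).Adelic) * (k : (quasiSplit (↥(maximalRealSubfield L)) L (IsCMField.complexConj L) 2).Adelic))) ∂ν)))‖ ≤ Cφ * (|((ν 𝓕).toReal⁻¹ : ℝ)| * (‖(((2 * π)⁻¹ : ℝ) : ℂ)‖ * ((∫ y : ℝ, ‖mellin f' (-((σ₀ : ℂ) + y * I))‖) * (r * r⁻¹ ^ σ₀ * (Cφ' * (∫ v : ↥(adelicUnipotent (↥(maximalRealSubfield L)) L (IsCMField.complexConj L) 2), (borelHeight (((quasiSplit (↥(maximalRealSubfield L)) L (IsCMField.complexConj L) 2).toAdelic (weylLongU ((IsCMField.complexConj L : L ≃ₐ[↥(maximalRealSubfield L)] L) : L →+* L) (rfl : (StdForm.antidiagonal 2).over L = (StdForm.antidiagonal 2).over L))) * (v : (quasiSplit (↥(maximalRealSubfield L)) L (IsCMField.complexConj L) 2).Adelic)) : ℝ) ^ σ₀ ∂ν)))))) := by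
  have hCφ : 0 ≤ Cφ := (norm_nonneg _).trans (hφC 1)
  obtain ⟨-, hGi⟩ := continuous_and_integrable_norm_mellin_neg hf' hf's hf'0 σ₀
  have hIb : ∀ y : ℝ, ‖∫ v : ↥(adelicUnipotent (↥(maximalRealSubfield L)) L (IsCMField.complexConj L) 2), flatSectionU φ' ((σ₀ : ℂ) + y * I) (((quasiSplit (↥(maximalRealSubfield L)) L (IsCMField.complexConj L) 2).toAdelic (weylLongU ((IsCMField.complexConj L : L ≃ₐ[↥(maximalRealSubfield L)] L) : L →+* L) (rfl : (StdForm.antidiagonal 2).over L = (StdForm.antidiagonal 2).over L))) * ((v : (quasiSplit (↥(maximalRealSubfield L)) L (IsCMField.complexConj L) 2).Adelic) * (k : (quasiSplit (↥(maximalRealSubfield L)) L (IsCMField.complexConj L) 2).Adelic))) ∂ν‖ ≤ Cφ' * (∫ v : ↥(adelicUnipotent (↥(maximalRealSubfield L)) L (IsCMField.complexConj L) 2), (borelHeight (((quasiSplit (↥(maximalRealSubfield L)) L (IsCMField.complexConj L) 2).toAdelic (weylLongU ((IsCMField.complexConj L : L ≃ₐ[↥(maximalRealSubfield L)] L) : L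 →+* L) (rfl : (StdForm.antidiagonal 2).over L = (StdForm.antidiagonal 2).over L))) * (v : (quasiSplit (↥(maximalRealSubfield L)) L (IsCMField.complexConj L) 2).Adelic)) : ℝ) ^ σ₀ ∂ν) := fun y => by
    have h := norm_integral_flatSectionU_weylLongU_maximalCompact_le_cm_two L ν h𝓕N h𝓕c hφ'C (z := (σ₀ : ℂ) + y * I) (by simpa using hσ₀) k
    simpa using h
  have hYb : ‖∫ y : ℝ, mellin f' (-((σ₀ : ℂ) + y * I)) * ((((r : ℝ) : ℂ) * (((r)⁻¹ : ℝ) : ℂ) ^ ((σ₀ : ℂ) + y * I)) * ∫ v : ↥(adelicUnipotent (↥(maximalRealSubfield L)) L (IsCMField.complexConj L) 2), flatSectionU φ' ((σ₀ : ℂ) + y * I) (((quasiSplit (↥(maximalRealSubfield L)) L (IsCMField.complexConj L) 2).toAdelic (weylLongU ((IsCMField.complexConj L : L ≃ₐ[↥(maximalRealSubfield L)] L) : L →+* L) (rfl : (StdForm.antidiagonal 2).over L = (StdForm.antidiagonal 2).over L))) * ((v : (quasiSplit (↥(maximalRealSubfield L)) L (IsCMField.complexConj L) 2).Adelic) * (k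 : (quasiSplit (↥(maximalRealSubfield L)) L (IsCMField.complexConj L) 2).Adelic))) ∂ν)‖ ≤ (∫ y : ℝ, ‖mellin f' (-((σ₀ : ℂ) + y * I))‖) * (r * r⁻¹ ^ σ₀ * (Cφ' * (∫ v : ↥(adelicUnipotent (↥(maximalRealSubfield L)) L (IsCMField.complexConj L) 2), (borelHeight (((quasiSplit (↥(maximalRealSubfield L)) L (IsCMField.complexConj L) 2).toAdelic (weylLongU ((IsCMField.complexConj L : L ≃ₐ[↥(maximalRealSubfield L)] L) : L →+* L) (rfl : (StdForm.antidiagonal 2).over L = (StdForm.antidiagonal 2).over L))) * (v : (quasiSplit (↥(maximalRealSubfield L)) L (IsCMField.complexConj L) 2).Adelic)) : ℝ) ^ σ₀ ∂ν))) := by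
    rw [← integral_mul_const]
    refine norm_integral_le_of_norm_le (hGi.mul_const _) (ae_of_all _ fun y => ?_)
    rw [norm_mul, norm_mul, norm_mul, Complex.norm_of_nonneg hr.le, Complex.norm_cpow_eq_rpow_re_of_pos (inv_pos.2 hr)]
    simp only [Complex.add_re, Complex.ofReal_re, Complex.mul_re, Complex.I_re, Complex.I_im, Complex.ofReal_im, mul_zero, zero_mul, sub_self, add_zero]
    exact mul_le_mul_of_nonneg_left (mul_le_mul_of_nonneg_left (hIb y) (mul_nonneg hr.le (Real.rpow_nonneg (inv_nonneg.2 hr.le) _))) (norm_nonneg _)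
  rw [norm_mul, Complex.norm_conj, norm_smul, Real.norm_eq_abs, norm_mul]
  exact mul_le_mul (hφC _) (mul_le_mul_of_nonneg_left (mul_le_mul_of_nonneg_left hYb (norm_nonneg _)) (abs_nonneg _))
    (mul_nonneg (abs_nonneg _) (mul_nonneg (norm_nonneg _) (norm_nonneg _))) hCφ

/-- **Domination ⇒ integrability on `(0,∞) × K_U`** of `F(r,k) = f(r)·r⁻²·T₂(r,k)`: on `supp f` one has `T⁻¹ ≤ r ≤ T` (★ `exists_one_le_forall_eq_zero`), so `‖F(r,k)‖ ≤ ‖f(r)‖·D`; `‖f‖ ∈ L¹`,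
`μ_K` finite (Mathlib `Integrable.mul_prod`, `Integrable.mono'`). [cite: MoeglinWaldspurger1995, II.2.1] -/
theorem integrable_w0_prod_cm_two (ν : Measure ↥(adelicUnipotent (↥(maximalRealSubfield L)) L (IsCMField.complexConj L) 2)) [ν.IsHaarMeasure] {𝓕 : Set ↥(adelicUnipotent (↥(maximalRealSubfield L)) L (IsCMField.complexConj L) 2)}
    (h𝓕N : IsFundamentalDomain ↥(rationalUnipotent (↥(maximalRealSubfield L)) L (IsCMField.complexConj L) 2) 𝓕 ν) (h𝓕c : IsCompact (closure 𝓕)) (μK : Measure ((standardMaximalCompactGL 2 L).comap (adelicVal (↥(maximalRealSubfield L)) L (IsCMField.complexConj L) 2 ((StdForm.antidiagonal 2).over L)) : Subgroup (quasiSplit (↥(maximalRealSubfield L)) L (IsCMField.complexConj L) 2).Adelic)) [IsFiniteMeasure μK]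
    {φ φ' : (quasiSplit (↥(maximalRealSubfield L)) L (IsCMField.complexConj L) 2).Adelic → ℂ} (hφc : Continuous φ) {Cφ : ℝ} (hφC : ∀ x, ‖φ x‖ ≤ Cφ) (hφ'c : Continuous φ') {Cφ' : ℝ} (hφ'C : ∀ x, ‖φ' x‖ ≤ Cφ') {f f' : ℝ → ℂ} (hf : ContDiff ℝ 2 f) (hfs : HasCompactSupport f) (hf0 : tsupport f ⊆ Ioi 0) (hf' : ContDiff ℝ 2 f') (hf's : HasCompactSupport f') (hf'0 : tsupport f' ⊆ Ioi 0) {σ₀ : ℝ} (hσ₀ : 1 < σ₀) :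
    Integrable (Function.uncurry fun (r : ℝ) (k : ((standardMaximalCompactGL 2 L).comap (adelicVal (↥(maximalRealSubfield L)) L (IsCMField.complexConj L) 2 ((StdForm.antidiagonal 2).over L)) : Subgroup (quasiSplit (↥(maximalRealSubfield L)) L (IsCMField.complexConj L) 2).Adelic)) => f r * ((r : ℝ) : ℂ) ^ (-2 : ℂ) * (φ (k : (quasiSplit (↥(maximalRealSubfield L)) L (IsCMField.complexConj L) 2).Adelic) * conj (((ν 𝓕).toReal⁻¹ : ℝ) • ((((2 * π)⁻¹ : ℝ) : ℂ) * ∫ y : ℝ, mellin f' (-((σ₀ : ℂ) + y * I)) * ((((r : ℝ) : ℂ) * (((r)⁻¹ : ℝ) : ℂ) ^ ((σ₀ : ℂ) + y * I)) * ∫ v : ↥(adelicUnipotent (↥(maximalRealSubfield L)) L (IsCMField.complexConj L) 2), flatSectionU φ' ((σ₀ : ℂ) + y * I) (((quasiSplit (↥(maximalRealSubfield L)) L (IsCMField.complexConj L) 2).toAdelic (weylLongU ((IsCMField.complexConj L : L ≃ₐ[↥(maximalRealSubfield L)] L) : L →+* L) (rfl : (StdForm.antidiagonal 2).over L = (StdForm.antidiagonal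 2).over L))) * ((v : (quasiSplit (↥(maximalRealSubfield L)) L (IsCMField.complexConj L) 2).Adelic) * (k : (quasiSplit (↥(maximalRealSubfield L)) L (IsCMField.complexConj L) 2).Adelic))) ∂ν))))) ((volume.restrict (Ioi (0 : ℝ))).prod μK) := by
  have hCφ : 0 ≤ Cφ := (norm_nonneg _).trans (hφC 1)
  have hCφ' : 0 ≤ Cφ' := (norm_nonneg _).trans (hφ'C 1)
  have hMf'0 : 0 ≤ (∫ y : ℝ, ‖mellin f' (-((σ₀ : ℂ) + y * I))‖) := integral_nonneg fun _ => norm_nonneg _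
  have hc₀0 : 0 ≤ (∫ v : ↥(adelicUnipotent (↥(maximalRealSubfield L)) L (IsCMField.complexConj L) 2), (borelHeight (((quasiSplit (↥(maximalRealSubfield L)) L (IsCMField.complexConj L) 2).toAdelic (weylLongU ((IsCMField.complexConj L : L ≃ₐ[↥(maximalRealSubfield L)] L) : L →+* L) (rfl : (StdForm.antidiagonal 2).over L = (StdForm.antidiagonal 2).over L))) * (v : (quasiSplit (↥(maximalRealSubfield L)) L (IsCMField.complexConj L) 2).Adelic)) : ℝ) ^ σ₀ ∂ν) := integral_nonneg fun _ => Real.rpow_nonneg (NNReal.coe_nonneg _) _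
  obtain ⟨T, hT, hhi, hlo⟩ := exists_one_le_forall_eq_zero hfs hf0
  have hT0 : (0 : ℝ) < T := by exact_mod_cast one_pos.trans_le hT
  set D₃ : ℝ := Cφ * (|((ν 𝓕).toReal⁻¹ : ℝ)| * (‖(((2 * π)⁻¹ : ℝ) : ℂ)‖ * ((∫ y : ℝ, ‖mellin f' (-((σ₀ : ℂ) + y * I))‖) * ((T : ℝ) * (T : ℝ) ^ σ₀ * (Cφ' * (∫ v : ↥(adelicUnipotent (↥(maximalRealSubfield L)) L (IsCMField.complexConj L) 2), (borelHeight (((quasiSplit (↥(maximalRealSubfield L)) L (IsCMField.complexConj L) 2).toAdelic (weylLongU ((IsCMField.complexConj L : L ≃ₐ[↥(maximalRealSubfield L)] L) : L →+* L) (rfl : (StdForm.antidiagonal 2).over L = (StdForm.antidiagonal 2).over L))) * (v : (quasiSplit (↥(maximalRealSubfield L)) L (IsCMField.complexConj L) 2).Adelic)) : ℝ) ^ σ₀ ∂ν)))))) * ((T : ℝ) * T) with hD₃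
  have hFb : ∀ (r : ℝ) (k : ((standardMaximalCompactGL 2 L).comap (adelicVal (↥(maximalRealSubfield L)) L (IsCMField.complexConj L) 2 ((StdForm.antidiagonal 2).over L)) : Subgroup (quasiSplit (↥(maximalRealSubfield L)) L (IsCMField.complexConj L) 2).Adelic)), ‖f r * ((r : ℝ) : ℂ) ^ (-2 : ℂ) * (φ (k : (quasiSplit (↥(maximalRealSubfield L)) L (IsCMField.complexConj L) 2).Adelic) * conj (((ν 𝓕).toReal⁻¹ : ℝ) • ((((2 * π)⁻¹ : ℝ) : ℂ) * ∫ y : ℝ, mellin f' (-((σ₀ : ℂ) + y * I)) * ((((r : ℝ) : ℂ) * (((r)⁻¹ : ℝ) : ℂ) ^ ((σ₀ : ℂ) + y * I)) * ∫ v : ↥(adelicUnipotent (↥(maximalRealSubfield L)) L (IsCMField.complexConj L) 2), flatSectionU φ' ((σ₀ : ℂ) + y * I) (((quasiSplit (↥(maximalRealSubfield L)) L (IsCMField.complexConj L) 2).toAdelic (weylLongU ((IsCMField.complexConj L : L ≃ₐ[↥(maximalRealSubfield L)] L) : L →+* L) (rfl : (StdForm.antidiagonal 2).over L = (StdForm.antidiagonal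 2).over L))) * ((v : (quasiSplit (↥(maximalRealSubfield L)) L (IsCMField.complexConj L) 2).Adelic) * (k : (quasiSplit (↥(maximalRealSubfield L)) L (IsCMField.complexConj L) 2).Adelic))) ∂ν))))‖ ≤ ‖f r‖ * D₃ := fun r k => by
    by_cases hfr : f r = 0
    · rw [hfr]
      simp only [zero_mul, norm_zero, le_refl]
    · have hTr : (T : ℝ)⁻¹ ≤ r := not_lt.1 fun h => hfr (hlo _ h)
      have hrT : r ≤ T := not_lt.1 fun h => hfr (hhi _ h)
      have hr : 0 < r := (inv_pos.2 hT0).trans_le hTr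
      have hinv : r⁻¹ ≤ T := by rw [inv_le_comm₀ hr hT0]; exact hTr
      have hpow : r * r⁻¹ ^ σ₀ ≤ (T : ℝ) * (T : ℝ) ^ σ₀ := mul_le_mul hrT (Real.rpow_le_rpow (inv_nonneg.2 hr.le) hinv (zero_le_one.trans hσ₀.le)) (Real.rpow_nonneg (inv_nonneg.2 hr.le) _) hT0.le
      have h2 : ‖((r : ℝ) : ℂ) ^ (-2 : ℂ)‖ ≤ (T : ℝ) * T := by
        rw [Complex.norm_cpow_eq_rpow_re_of_pos hr]
        simp only [Complex.neg_re, Complex.re_ofNat]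
        rw [Real.rpow_neg hr.le, show (2 : ℝ) = ((2 : ℕ) : ℝ) by norm_num, Real.rpow_natCast, pow_two, mul_inv]
        exact mul_le_mul hinv hinv (inv_nonneg.2 hr.le) hT0.le
      rw [norm_mul, norm_mul, mul_assoc]
      refine mul_le_mul_of_nonneg_left ?_ (norm_nonneg _)
      rw [hD₃, mul_comm (‖((r : ℝ) : ℂ) ^ (-2 : ℂ)‖)]
      exact mul_le_mul ((norm_w0Integrand_le_cm_two L ν h𝓕N h𝓕c hφC hφ'C hf' hf's hf'0 hσ₀ hr k).trans
        (mul_le_mul_of_nonneg_left (mul_le_mul_of_nonneg_left (mul_le_mul_of_nonneg_left (mul_le_mul_of_nonneg_left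
        (mul_le_mul_of_nonneg_right hpow (mul_nonneg hCφ' hc₀0)) hMf'0) (norm_nonneg _)) (abs_nonneg _)) hCφ)) h2 (norm_nonneg _)
        (mul_nonneg hCφ (mul_nonneg (abs_nonneg _) (mul_nonneg (norm_nonneg _) (mul_nonneg hMf'0 (mul_nonneg (mul_nonneg hT0.le (Real.rpow_nonneg hT0.le _)) (mul_nonneg hCφ' hc₀0))))))
  have hFm : Measurable fun p : ℝ × ((standardMaximalCompactGL 2 L).comap (adelicVal (↥(maximalRealSubfield L)) L (IsCMField.complexConj L) 2 ((StdForm.antidiagonal 2).over L)) : Subgroup (quasiSplit (↥(maximalRealSubfield L)) L (IsCMField.complexConj L) 2).Adelic) => f p.1 * ((p.1 : ℝ) : ℂ) ^ (-2 : ℂ) * (φ (p.2 : (quasiSplit (↥(maximalRealSubfield L)) L (IsCMField.complexConj L) 2).Adelic) * conj (((ν 𝓕).toReal⁻¹ : ℝ) • ((((2 * π)⁻¹ : ℝ) : ℂ) * ∫ y : ℝ, mellin f' (-((σ₀ : ℂ) + y * I)) * ((((p.1 : ℝ) : ℂ) * (((p.1)⁻¹ : ℝ) : ℂ) ^ ((σ₀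 : ℂ) + y * I)) * ∫ v : ↥(adelicUnipotent (↥(maximalRealSubfield L)) L (IsCMField.complexConj L) 2), flatSectionU φ' ((σ₀ : ℂ) + y * I) (((quasiSplit (↥(maximalRealSubfield L)) L (IsCMField.complexConj L) 2).toAdelic (weylLongU ((IsCMField.complexConj L : L ≃ₐ[↥(maximalRealSubfield L)] L) : L →+* L) (rfl : (StdForm.antidiagonal 2).over L = (StdForm.antidiagonal 2).over L))) * ((v : (quasiSplit (↥(maximalRealSubfield L)) L (IsCMField.complexConj L) 2).Adelic) * (p.2 : (quasiSplit (↥(maximalRealSubfield L)) L (IsCMField.complexConj L) 2).Adelic))) ∂ν)))) :=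
    (((hf.continuous.measurable.comp measurable_fst)).mul ((continuous_ofReal.measurable.comp measurable_fst).pow measurable_const)).mul
      (measurable_w0Integrand_cm_two L ν 𝓕 hφc hφ'c hf' hf's hf'0 σ₀)
  have hdom : Integrable (fun p : ℝ × ((standardMaximalCompactGL 2 L).comap (adelicVal (↥(maximalRealSubfield L)) L (IsCMField.complexConj L) 2 ((StdForm.antidiagonal 2).over L)) : Subgroup (quasiSplit (↥(maximalRealSubfield L)) L (IsCMField.complexConj L) 2).Adelic) => ‖f p.1‖ * D₃) ((volume.restrict (Ioi (0 : ℝ))).prod μK) :=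
    ((hf.continuous.integrable_of_hasCompactSupport hfs).norm.integrableOn.integrable.mul_prod (integrable_const D₃))
  exact hdom.mono' hFm.aestronglyMeasurable (ae_of_all _ fun p => hFb p.1 p.2)

/-- **The inner `dr`-integral for fixed `k`: ★ A Parseval II with the scalar `c(z) = I_{φ′}(z,k)`** (continuous in `y` by §1, bounded by ★ H-a §1; `r·(r⁻¹)^z = r^{1−z}`; the real scalar
`(ν𝓕)⁻¹` and `φ(k)` leave the integral). [cite: Titchmarsh1948, Thm 71–72] [cite: MoeglinWaldspurger1995, II.2.1] -/
theorem setIntegral_w0_inner_eq_cm_two (ν : Measure ↥(adelicUnipotent (↥(maximalRealSubfield L)) L (IsCMField.complexConj L) 2)) [ν.IsHaarMeasure] {𝓕 : Set ↥(adelicUnipotent (↥(maximalRealSubfield L)) L (IsCMField.complexConj L) 2)}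
    (h𝓕N : IsFundamentalDomain ↥(rationalUnipotent (↥(maximalRealSubfield L)) L (IsCMField.complexConj L) 2) 𝓕 ν) (h𝓕c : IsCompact (closure 𝓕))
    {φ φ' : (quasiSplit (↥(maximalRealSubfield L)) L (IsCMField.complexConj L) 2).Adelic → ℂ} (hφ'c : Continuous φ') {Cφ' : ℝ} (hφ'C : ∀ x, ‖φ' x‖ ≤ Cφ') {f f' : ℝ → ℂ} (hf : ContDiff ℝ 2 f) (hfs : HasCompactSupport f) (hf0 : tsupport f ⊆ Ioi 0) (hf' : ContDiff ℝ 2 f') (hf's : HasCompactSupport f') (hf'0 : tsupport f' ⊆ Ioi 0) {σ₀ : ℝ} (hσ₀ : 1 < σ₀) (k : ((standardMaximalCompactGL 2 L).comap (adelicVal (↥(maximalRealSubfield L)) L (IsCMField.complexConj L) 2 ((StdForm.antidiagonal 2).over L)) : Subgroup (quasiSplit (↥(maximalRealSubfield L)) L (IsCMField.complexConj L) 2).Adelic)) :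
    ∫ r in Ioi (0 : ℝ), f r * ((r : ℝ) : ℂ) ^ (-2 : ℂ) * (φ (k : (quasiSplit (↥(maximalRealSubfield L)) L (IsCMField.complexConj L) 2).Adelic) * conj (((ν 𝓕).toReal⁻¹ : ℝ) • ((((2 * π)⁻¹ : ℝ) : ℂ) * ∫ y : ℝ, mellin f' (-((σ₀ : ℂ) + y * I)) * ((((r : ℝ) : ℂ) * (((r)⁻¹ : ℝ) : ℂ) ^ ((σ₀ : ℂ) + y * I)) * ∫ v : ↥(adelicUnipotent (↥(maximalRealSubfield L)) L (IsCMField.complexConj L) 2), flatSectionU φ' ((σ₀ : ℂ) + y * I) (((quasiSplit (↥(maximalRealSubfield L)) L (IsCMField.complexConj L) 2).toAdelic (weylLongU ((IsCMField.complexConj L : L ≃ₐ[↥(maximalRealSubfield L)] L) : L →+* L) (rfl : (StdForm.antidiagonal 2).over L = (StdForm.antidiagonal 2).over L))) * ((v : (quasiSplit (↥(maximalRealSubfield L)) L (IsCMField.complexConj L) 2).Adelic) * (k : (quasiSplit (↥(maximalRealSubfield L)) L (IsCMField.complexConj L) 2).Adelic))) ∂ν)))) = ((((ν 𝓕).toReal⁻¹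 : ℝ)) : ℂ) * (φ (k : (quasiSplit (↥(maximalRealSubfield L)) L (IsCMField.complexConj L) 2).Adelic) * ((((2 * π)⁻¹ : ℝ) : ℂ) * ∫ y : ℝ, mellin f (-((σ₀ : ℂ) + y * I)) * conj (mellin f' (-conj ((σ₀ : ℂ) + y * I))) * conj (∫ v : ↥(adelicUnipotent (↥(maximalRealSubfield L)) L (IsCMField.complexConj L) 2), flatSectionU φ' (conj ((σ₀ : ℂ) + y * I)) (((quasiSplit (↥(maximalRealSubfield L)) L (IsCMField.complexConj L) 2).toAdelic (weylLongU ((IsCMField.complexConj L : L ≃ₐ[↥(maximalRealSubfield L)] L) : L →+* L) (rfl : (StdForm.antidiagonal 2).over L = (StdForm.antidiagonal 2).over L))) * ((v : (quasiSplit (↥(maximalRealSubfield L)) L (IsCMField.complexConj L) 2).Adelic) * (k : (quasiSplit (↥(maximalRealSubfield L)) L (IsCMField.complexConj L) 2).Adelic))) ∂ν))) := by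
  have hIb : ∀ y : ℝ, ‖∫ v : ↥(adelicUnipotent (↥(maximalRealSubfield L)) L (IsCMField.complexConj L) 2), flatSectionU φ' ((σ₀ : ℂ) + y * I) (((quasiSplit (↥(maximalRealSubfield L)) L (IsCMField.complexConj L) 2).toAdelic (weylLongU ((IsCMField.complexConj L : L ≃ₐ[↥(maximalRealSubfield L)] L) : L →+* L) (rfl : (StdForm.antidiagonal 2).over L = (StdForm.antidiagonal 2).over L))) * ((v : (quasiSplit (↥(maximalRealSubfield L)) L (IsCMField.complexConj L) 2).Adelic) * (k : (quasiSplit (↥(maximalRealSubfield L)) L (IsCMField.complexConj L) 2).Adelic))) ∂ν‖ ≤ Cφ' * (∫ v : ↥(adelicUnipotent (↥(maximalRealSubfield L)) L (IsCMField.complexConj L) 2), (borelHeight (((quasiSplit (↥(maximalRealSubfield L)) L (IsCMField.complexConj L) 2).toAdelic (weylLongU ((IsCMField.complexConj L : L ≃ₐ[↥(maximalRealSubfield L)] L) : L →+* L) (rfl : (StdForm.antidiagonal 2).over L = (StdForm.antidiagonal 2).over L))) * (v : (quasiSplit (↥(maximalRealSubfield L)) L (IsCMField.complexConj L) 2).Adelic))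 : ℝ) ^ σ₀ ∂ν) := fun y => by
    have h := norm_integral_flatSectionU_weylLongU_maximalCompact_le_cm_two L ν h𝓕N h𝓕c hφ'C (z := (σ₀ : ℂ) + y * I) (by simpa using hσ₀) k
    simpa using h
  have hIcont : Continuous fun y : ℝ => ∫ v : ↥(adelicUnipotent (↥(maximalRealSubfield L)) L (IsCMField.complexConj L) 2), flatSectionU φ' ((σ₀ : ℂ) + y * I) (((quasiSplit (↥(maximalRealSubfield L)) L (IsCMField.complexConj L) 2).toAdelic (weylLongU ((IsCMField.complexConj L : L ≃ₐ[↥(maximalRealSubfield L)] L) : L →+* L) (rfl : (StdForm.antidiagonal 2).over L = (StdForm.antidiagonal 2).over L))) * ((v : (quasiSplit (↥(maximalRealSubfield L)) L (IsCMField.complexConj L) 2).Adelic) * (k : (quasiSplit (↥(maximalRealSubfield L)) L (IsCMField.complexConj L) 2).Adelic))) ∂ν := continuous_integral_flatSectionU_weylLongU_vertical_cm_two L ν h𝓕N h𝓕c hφ'c hφ'C hσ₀ (k : (quasiSplit (↥(maximalRealSubfield L)) L (IsCMField.complexConj L) 2).Adelic)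
  have hYP : ∀ r ∈ Ioi (0 : ℝ), ∫ y : ℝ, mellin f' (-((σ₀ : ℂ) + y * I)) * ((((r : ℝ) : ℂ) * (((r)⁻¹ : ℝ) : ℂ) ^ ((σ₀ : ℂ) + y * I)) * ∫ v : ↥(adelicUnipotent (↥(maximalRealSubfield L)) L (IsCMField.complexConj L) 2), flatSectionU φ' ((σ₀ : ℂ) + y * I) (((quasiSplit (↥(maximalRealSubfield L)) L (IsCMField.complexConj L) 2).toAdelic (weylLongU ((IsCMField.complexConj L : L ≃ₐ[↥(maximalRealSubfield L)] L) : L →+* L) (rfl : (StdForm.antidiagonal 2).over L = (StdForm.antidiagonal 2).over L))) * ((v : (quasiSplit (↥(maximalRealSubfield L)) L (IsCMField.complexConj L) 2).Adelic) * (k : (quasiSplit (↥(maximalRealSubfield L)) L (IsCMField.complexConj L) 2).Adelic))) ∂ν) = ∫ y : ℝ, mellin f' (-((σ₀ : ℂ) + y * I)) * (∫ v : ↥(adelicUnipotent (↥(maximalRealSubfield L)) L (IsCMField.complexConj L) 2), flatSectionU φ' ((σ₀ : ℂ) + y * I) (((quasiSplit (↥(maximalRealSubfield L)) L (IsCMField.complexConj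 L) 2).toAdelic (weylLongU ((IsCMField.complexConj L : L ≃ₐ[↥(maximalRealSubfield L)] L) : L →+* L) (rfl : (StdForm.antidiagonal 2).over L = (StdForm.antidiagonal 2).over L))) * ((v : (quasiSplit (↥(maximalRealSubfield L)) L (IsCMField.complexConj L) 2).Adelic) * (k : (quasiSplit (↥(maximalRealSubfield L)) L (IsCMField.complexConj L) 2).Adelic))) ∂ν) * ((r : ℝ) : ℂ) ^ (1 - ((σ₀ : ℂ) + y * I)) := fun r hr => by
    refine integral_congr_ae (ae_of_all _ fun y => ?_)
    dsimp only
    rw [← ofReal_mul_ofReal_inv_cpow hr]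
    ring
  have hsc : ∀ (a b Z : ℂ), a * (b * conj (((ν 𝓕).toReal⁻¹ : ℝ) • Z)) = ((((ν 𝓕).toReal⁻¹ : ℝ)) : ℂ) * (b * (a * conj Z)) := fun a b Z => by
    rw [Complex.real_smul, map_mul, Complex.conj_ofReal]
    ring
  have h1 : ∀ r ∈ Ioi (0 : ℝ), f r * ((r : ℝ) : ℂ) ^ (-2 : ℂ) * (φ (k : (quasiSplit (↥(maximalRealSubfield L)) L (IsCMField.complexConj L) 2).Adelic) * conj (((ν 𝓕).toReal⁻¹ : ℝ) • ((((2 * π)⁻¹ : ℝ) : ℂ) * ∫ y : ℝ, mellin f' (-((σ₀ : ℂ) + y * I)) * ((((r : ℝ) : ℂ) * (((r)⁻¹ : ℝ) : ℂ) ^ ((σ₀ : ℂ) + y * I)) * ∫ v : ↥(adelicUnipotent (↥(maximalRealSubfield L)) L (IsCMField.complexConj L) 2), flatSectionU φ' ((σ₀ : ℂ) + y * I) (((quasiSplit (↥(maximalRealSubfield L)) L (IsCMField.complexConj L) 2).toAdelic (weylLongU ((IsCMField.complexConj L : L ≃ₐ[↥(maximalRealSubfield L)] L) : L →+* L) (rfl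 : (StdForm.antidiagonal 2).over L = (StdForm.antidiagonal 2).over L))) * ((v : (quasiSplit (↥(maximalRealSubfield L)) L (IsCMField.complexConj L) 2).Adelic) * (k : (quasiSplit (↥(maximalRealSubfield L)) L (IsCMField.complexConj L) 2).Adelic))) ∂ν)))) =
      ((((ν 𝓕).toReal⁻¹ : ℝ)) : ℂ) * (φ (k : (quasiSplit (↥(maximalRealSubfield L)) L (IsCMField.complexConj L) 2).Adelic) * (f r * ((r : ℝ) : ℂ) ^ (-2 : ℂ) * conj ((((2 * π)⁻¹ : ℝ) : ℂ) * ∫ y : ℝ, mellin f' (-((σ₀ : ℂ) + y * I)) * (∫ v : ↥(adelicUnipotent (↥(maximalRealSubfield L)) L (IsCMField.complexConj L) 2), flatSectionU φ' ((σ₀ : ℂ) + y * I) (((quasiSplit (↥(maximalRealSubfield L)) L (IsCMField.complexConj L) 2).toAdelic (weylLongU ((IsCMField.complexConj L : L ≃ₐ[↥(maximalRealSubfield L)] L) : L →+* L) (rfl : (StdForm.antidiagonal 2).over L = (StdForm.antidiagonal 2).over L))) * ((v : (quasiSplit (↥(maximalRealSubfield L)) L (IsCMField.complexConj L) 2).Adelic)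 * (k : (quasiSplit (↥(maximalRealSubfield L)) L (IsCMField.complexConj L) 2).Adelic))) ∂ν) * ((r : ℝ) : ℂ) ^ (1 - ((σ₀ : ℂ) + y * I))))) := fun r hr => by
    rw [hYP r hr]
    exact hsc _ _ _
  have hP := setIntegral_mul_cpow_mul_conj_integral_eq hf.continuous hfs hf0 hf' hf's hf'0 σ₀ (c := fun w : ℂ => ∫ v : ↥(adelicUnipotent (↥(maximalRealSubfield L)) L (IsCMField.complexConj L) 2), flatSectionU φ' w (((quasiSplit (↥(maximalRealSubfield L)) L (IsCMField.complexConj L) 2).toAdelic (weylLongU ((IsCMField.complexConj L : L ≃ₐ[↥(maximalRealSubfield L)] L) : L →+* L) (rfl : (StdForm.antidiagonal 2).over L = (StdForm.antidiagonal 2).over L))) * ((v : (quasiSplit (↥(maximalRealSubfield L)) L (IsCMField.complexConj L) 2).Adelic) * (k : (quasiSplit (↥(maximalRealSubfield L)) L (IsCMField.complexConj L) 2).Adelic))) ∂ν) hIcont hIb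
  beta_reduce at hP
  rw [setIntegral_congr_fun measurableSet_Ioi h1, integral_const_mul, integral_const_mul, hP]

/-- **The `w = w₀` radial integral**: `∫_0^∞ (f(r)·∫_{K_U} T₂(r,k) dμ_K)·r⁻² dr = (ν𝓕)⁻¹·∫_{K_U} φ(k)·( (2π)⁻¹∫ f̃(z)·conj f̃′(z̄)·conj I_{φ′}(z̄,k) dy ) dμ_K` — Fubini (previous two lemmas) then
Parseval II per `k`. [cite: MoeglinWaldspurger1995, II.2.1] [cite: Titchmarsh1948, Thm 71–72] -/
theorem setIntegral_w0_radial_eq_cm_two (ν : Measure ↥(adelicUnipotent (↥(maximalRealSubfield L)) L (IsCMField.complexConj L) 2)) [ν.IsHaarMeasure] {𝓕 : Set ↥(adelicUnipotent (↥(maximalRealSubfield L)) L (IsCMField.complexConj L) 2)}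
    (h𝓕N : IsFundamentalDomain ↥(rationalUnipotent (↥(maximalRealSubfield L)) L (IsCMField.complexConj L) 2) 𝓕 ν) (h𝓕c : IsCompact (closure 𝓕)) (μK : Measure ((standardMaximalCompactGL 2 L).comap (adelicVal (↥(maximalRealSubfield L)) L (IsCMField.complexConj L) 2 ((StdForm.antidiagonal 2).over L)) : Subgroup (quasiSplit (↥(maximalRealSubfield L)) L (IsCMField.complexConj L) 2).Adelic)) [IsFiniteMeasure μK]
    {φ φ' : (quasiSplit (↥(maximalRealSubfield L)) L (IsCMField.complexConj L) 2).Adelic → ℂ} (hφc : Continuous φ) {Cφ : ℝ} (hφC : ∀ x, ‖φ x‖ ≤ Cφ) (hφ'c : Continuous φ') {Cφ' : ℝ} (hφ'C : ∀ x, ‖φ' x‖ ≤ Cφ') {f f' : ℝ → ℂ} (hf : ContDiff ℝ 2 f) (hfs : HasCompactSupport f) (hf0 : tsupport f ⊆ Ioi 0) (hf' : ContDiff ℝ 2 f') (hf's : HasCompactSupport f') (hf'0 : tsupport f' ⊆ Ioi 0) {σ₀ : ℝ} (hσ₀ : 1 < σ₀) :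
    ∫ r in Ioi (0 : ℝ), (f r * ∫ k : ((standardMaximalCompactGL 2 L).comap (adelicVal (↥(maximalRealSubfield L)) L (IsCMField.complexConj L) 2 ((StdForm.antidiagonal 2).over L)) : Subgroup (quasiSplit (↥(maximalRealSubfield L)) L (IsCMField.complexConj L) 2).Adelic), φ (k : (quasiSplit (↥(maximalRealSubfield L)) L (IsCMField.complexConj L) 2).Adelic) * conj (((ν 𝓕).toReal⁻¹ : ℝ) • ((((2 * π)⁻¹ : ℝ) : ℂ) * ∫ y : ℝ, mellin f' (-((σ₀ : ℂ) + y * I)) * ((((r : ℝ) : ℂ) * (((r)⁻¹ : ℝ) : ℂ) ^ ((σ₀ : ℂ) + y * I)) * ∫ v : ↥(adelicUnipotent (↥(maximalRealSubfield L)) L (IsCMField.complexConj L) 2), flatSectionU φ' ((σ₀ : ℂ) + y * I) (((quasiSplit (↥(maximalRealSubfield L)) L (IsCMField.complexConj L) 2).toAdelic (weylLongU ((IsCMField.complexConj L : L ≃ₐ[↥(maximalRealSubfield L)] L) : L →+* L) (rfl : (StdForm.antidiagonal 2).over L = (StdForm.antidiagonal 2).over L))) * ((v : (quasiSplit (↥(maximalRealSubfield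 L)) L (IsCMField.complexConj L) 2).Adelic) * (k : (quasiSplit (↥(maximalRealSubfield L)) L (IsCMField.complexConj L) 2).Adelic))) ∂ν))) ∂μK) * ((r : ℝ) : ℂ) ^ (-2 : ℂ) = ((((ν 𝓕).toReal⁻¹ : ℝ)) : ℂ) * ∫ k : ((standardMaximalCompactGL 2 L).comap (adelicVal (↥(maximalRealSubfield L)) L (IsCMField.complexConj L) 2 ((StdForm.antidiagonal 2).over L)) : Subgroup (quasiSplit (↥(maximalRealSubfield L)) L (IsCMField.complexConj L) 2).Adelic), φ (k : (quasiSplit (↥(maximalRealSubfield L)) L (IsCMField.complexConj L) 2).Adelic) * ((((2 * π)⁻¹ : ℝ) : ℂ) * ∫ y : ℝ, mellin f (-((σ₀ : ℂ) + y * I)) * conj (mellin f' (-conj ((σ₀ : ℂ) + y * I))) * conj (∫ v : ↥(adelicUnipotent (↥(maximalRealSubfield L)) L (IsCMField.complexConj L) 2), flatSectionU φ' (conj ((σ₀ : ℂ) + y * I)) (((quasiSplit (↥(maximalRealSubfield L)) L (IsCMField.complexConj L) 2).toAdelic (weylLongU ((IsCMField.complexConj L : L ≃ₐ[↥(maximalRealSubfield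 L)] L) : L →+* L) (rfl : (StdForm.antidiagonal 2).over L = (StdForm.antidiagonal 2).over L))) * ((v : (quasiSplit (↥(maximalRealSubfield L)) L (IsCMField.complexConj L) 2).Adelic) * (k : (quasiSplit (↥(maximalRealSubfield L)) L (IsCMField.complexConj L) 2).Adelic))) ∂ν)) ∂μK := by
  have h3 : ∫ r in Ioi (0 : ℝ), (f r * ∫ k : ((standardMaximalCompactGL 2 L).comap (adelicVal (↥(maximalRealSubfield L)) L (IsCMField.complexConj L) 2 ((StdForm.antidiagonal 2).over L)) : Subgroup (quasiSplit (↥(maximalRealSubfield L)) L (IsCMField.complexConj L) 2).Adelic), φ (k : (quasiSplit (↥(maximalRealSubfield L)) L (IsCMField.complexConj L) 2).Adelic) * conj (((ν 𝓕).toReal⁻¹ : ℝ) • ((((2 * π)⁻¹ : ℝ) : ℂ) * ∫ y : ℝ, mellin f' (-((σ₀ : ℂ) + y * I)) * ((((r : ℝ) : ℂ) * (((r)⁻¹ : ℝ) : ℂ) ^ ((σ₀ : ℂ) + y * I)) * ∫ v : ↥(adelicUnipotent (↥(maximalRealSubfield L)) L (IsCMField.complexConj L) 2), flatSectionU φ'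 ((σ₀ : ℂ) + y * I) (((quasiSplit (↥(maximalRealSubfield L)) L (IsCMField.complexConj L) 2).toAdelic (weylLongU ((IsCMField.complexConj L : L ≃ₐ[↥(maximalRealSubfield L)] L) : L →+* L) (rfl : (StdForm.antidiagonal 2).over L = (StdForm.antidiagonal 2).over L))) * ((v : (quasiSplit (↥(maximalRealSubfield L)) L (IsCMField.complexConj L) 2).Adelic) * (k : (quasiSplit (↥(maximalRealSubfield L)) L (IsCMField.complexConj L) 2).Adelic))) ∂ν))) ∂μK) * ((r : ℝ) : ℂ) ^ (-2 : ℂ) = ∫ r in Ioi (0 : ℝ), ∫ k : ((standardMaximalCompactGL 2 L).comap (adelicVal (↥(maximalRealSubfield L)) L (IsCMField.complexConj L) 2 ((StdForm.antidiagonal 2).over L)) : Subgroup (quasiSplit (↥(maximalRealSubfield L)) L (IsCMField.complexConj L) 2).Adelic), f r * ((r : ℝ) : ℂ) ^ (-2 : ℂ) * (φ (k : (quasiSplit (↥(maximalRealSubfield L)) L (IsCMField.complexConj L) 2).Adelic) * conj (((ν 𝓕).toReal⁻¹ : ℝ) • ((((2 * π)⁻¹ : ℝ) : ℂ) * ∫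 y : ℝ, mellin f' (-((σ₀ : ℂ) + y * I)) * ((((r : ℝ) : ℂ) * (((r)⁻¹ : ℝ) : ℂ) ^ ((σ₀ : ℂ) + y * I)) * ∫ v : ↥(adelicUnipotent (↥(maximalRealSubfield L)) L (IsCMField.complexConj L) 2), flatSectionU φ' ((σ₀ : ℂ) + y * I) (((quasiSplit (↥(maximalRealSubfield L)) L (IsCMField.complexConj L) 2).toAdelic (weylLongU ((IsCMField.complexConj L : L ≃ₐ[↥(maximalRealSubfield L)] L) : L →+* L) (rfl : (StdForm.antidiagonal 2).over L = (StdForm.antidiagonal 2).over L))) * ((v : (quasiSplit (↥(maximalRealSubfield L)) L (IsCMField.complexConj L) 2).Adelic) * (k : (quasiSplit (↥(maximalRealSubfield L)) L (IsCMField.complexConj L) 2).Adelic))) ∂ν)))) ∂μK :=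
    setIntegral_congr_fun measurableSet_Ioi fun r _ => by
      rw [integral_const_mul]
      ring
  have hswap := integral_integral_swap (integrable_w0_prod_cm_two L ν h𝓕N h𝓕c μK hφc hφC hφ'c hφ'C hf hfs hf0 hf' hf's hf'0 hσ₀)
  have h5 : ∫ k : ((standardMaximalCompactGL 2 L).comap (adelicVal (↥(maximalRealSubfield L)) L (IsCMField.complexConj L) 2 ((StdForm.antidiagonal 2).over L)) : Subgroup (quasiSplit (↥(maximalRealSubfield L)) L (IsCMField.complexConj L) 2).Adelic), (∫ r in Ioi (0 : ℝ), f r * ((r : ℝ) : ℂ) ^ (-2 : ℂ) * (φ (k : (quasiSplit (↥(maximalRealSubfield L)) L (IsCMField.complexConj L) 2).Adelic) * conj (((ν 𝓕).toReal⁻¹ : ℝ) • ((((2 * π)⁻¹ : ℝ) : ℂ) * ∫ y : ℝ, mellin f' (-((σ₀ : ℂ) + y * I)) * ((((r : ℝ) : ℂ) * (((r)⁻¹ : ℝ) : ℂ) ^ ((σ₀ : ℂ) + y * I)) * ∫ v : ↥(adelicUnipotent (↥(maximalRealSubfield L)) L (IsCMField.complexConj L) 2), flatSectionU φ' ((σ₀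 : ℂ) + y * I) (((quasiSplit (↥(maximalRealSubfield L)) L (IsCMField.complexConj L) 2).toAdelic (weylLongU ((IsCMField.complexConj L : L ≃ₐ[↥(maximalRealSubfield L)] L) : L →+* L) (rfl : (StdForm.antidiagonal 2).over L = (StdForm.antidiagonal 2).over L))) * ((v : (quasiSplit (↥(maximalRealSubfield L)) L (IsCMField.complexConj L) 2).Adelic) * (k : (quasiSplit (↥(maximalRealSubfield L)) L (IsCMField.complexConj L) 2).Adelic))) ∂ν))))) ∂μK = ((((ν 𝓕).toReal⁻¹ : ℝ)) : ℂ) * ∫ k : ((standardMaximalCompactGL 2 L).comap (adelicVal (↥(maximalRealSubfield L)) L (IsCMField.complexConj L) 2 ((StdForm.antidiagonal 2).over L)) : Subgroup (quasiSplit (↥(maximalRealSubfield L)) L (IsCMField.complexConj L) 2).Adelic), φ (k : (quasiSplit (↥(maximalRealSubfield L)) L (IsCMField.complexConj L) 2).Adelic) * ((((2 * π)⁻¹ : ℝ) : ℂ) * ∫ y : ℝ, mellin f (-((σ₀ : ℂ) + y * I)) * conj (mellin f' (-conj ((σ₀ : ℂ) + y * I))) * conj (∫ v : ↥(adelicUnipotent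 (↥(maximalRealSubfield L)) L (IsCMField.complexConj L) 2), flatSectionU φ' (conj ((σ₀ : ℂ) + y * I)) (((quasiSplit (↥(maximalRealSubfield L)) L (IsCMField.complexConj L) 2).toAdelic (weylLongU ((IsCMField.complexConj L : L ≃ₐ[↥(maximalRealSubfield L)] L) : L →+* L) (rfl : (StdForm.antidiagonal 2).over L = (StdForm.antidiagonal 2).over L))) * ((v : (quasiSplit (↥(maximalRealSubfield L)) L (IsCMField.complexConj L) 2).Adelic) * (k : (quasiSplit (↥(maximalRealSubfield L)) L (IsCMField.complexConj L) 2).Adelic))) ∂ν)) ∂μK :=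
    (congrArg (fun F : ((standardMaximalCompactGL 2 L).comap (adelicVal (↥(maximalRealSubfield L)) L (IsCMField.complexConj L) 2 ((StdForm.antidiagonal 2).over L)) : Subgroup (quasiSplit (↥(maximalRealSubfield L)) L (IsCMField.complexConj L) 2).Adelic) → ℂ => ∫ k, F k ∂μK) (funext fun k => setIntegral_w0_inner_eq_cm_two L ν h𝓕N h𝓕c hφ'c hφ'C hf hfs hf0 hf' hf's hf'0 hσ₀ k)).trans
      (integral_const_mul _ _)
  exact h3.trans (hswap.trans h5)

variable [MeasurableSpace (AdeleRing (𝓞 L) L)ˣ] [BorelSpace (AdeleRing (𝓞 L) L)ˣ]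

/-! ## §3 (SD): the self-dual two-term formula -/

/-- **(SD) THE SELF-DUAL TWO-TERM INNER PRODUCT FORMULA.**  Data as in ★ W-b∕H-a; there is ONE `C > 0` (`= c_μ·K·V`) such that for every UNITARY SELF-DUAL Hecke character `χ` (`χʷ = χ`,
`χʷ = reflectChar c χ`), all continuous bounded `χ`-sections `φ, φ′`, all `f, f′ ∈ C²_c((0,∞))` and every `σ₀ > 1` (`z = σ₀ + iy`, `I(w,k) = ∫_{N(𝔸)}(φ′H^w)(w₀ v k) dν`):
**`∫_X θ_{f,φ}·conj θ_{f′,φ′} dμ = C·( (2π)⁻¹∫_ℝ f̃(z)·conj f̃′(z̄ − 1) dy · ∫_{K_U} φ conj φ′ dμ_K + (ν𝓕)⁻¹ • ∫_{K_U} φ(k)·( (2π)⁻¹∫_ℝ f̃(z)·conj f̃′(z̄)·conj I(z̄, k) dy ) dμ_K )`** —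
the `w = 1` term (★ C ∘ ★ A Parseval I) plus the `w = w₀` term (★ C ∘ §2), the twin of ★ Final `pseudoEisenstein_inner_product_cm_two` (`φ = φ′ = 1`, `χ = 1`: `conj I(z̄,k) = c(z)`).
[cite: MoeglinWaldspurger1995, II.2.1] [cite: Rogawski1990, §7.3 (pp. 96–98)] [cite: Titchmarsh1948, Thm 71–72] -/
theorem chiPseudoEisenstein_inner_product_selfDual_cm_two
    (μ : Measure (quasiSplit (↥(maximalRealSubfield L)) L (IsCMField.complexConj L) 2).automorphicQuotient) [(quasiSplit (↥(maximalRealSubfield L)) L (IsCMField.complexConj L) 2).IsAutomorphicMeasure μ]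
    (νG : Measure (quasiSplit (↥(maximalRealSubfield L)) L (IsCMField.complexConj L) 2).Adelic) [νG.IsHaarMeasure] [νG.IsInvInvariant]
    (μK : Measure ((standardMaximalCompactGL 2 L).comap (adelicVal (↥(maximalRealSubfield L)) L (IsCMField.complexConj L) 2 ((StdForm.antidiagonal 2).over L)) : Subgroup (quasiSplit (↥(maximalRealSubfield L)) L (IsCMField.complexConj L) 2).Adelic)) [μK.IsHaarMeasure]
    (νI : Measure (AdeleRing (𝓞 L) L)ˣ) [νI.IsHaarMeasure]
    {𝓕I : Set (AdeleRing (𝓞 L) L)ˣ} (h𝓕I : IsIdeleClassDomain L 𝓕I)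
    (ν : Measure ↥(adelicUnipotent (↥(maximalRealSubfield L)) L (IsCMField.complexConj L) 2)) [ν.IsHaarMeasure] {𝓕 : Set ↥(adelicUnipotent (↥(maximalRealSubfield L)) L (IsCMField.complexConj L) 2)}
    (h𝓕N : IsFundamentalDomain ↥(rationalUnipotent (↥(maximalRealSubfield L)) L (IsCMField.complexConj L) 2) 𝓕 ν) (h𝓕c : IsCompact (closure 𝓕)) (h𝓕₀ : ν 𝓕 ≠ 0) :
    ∃ C : ℝ, 0 < C ∧
      ∀ {χ : HeckeCharacter L} {φ φ' : (quasiSplit (↥(maximalRealSubfield L)) L (IsCMField.complexConj L) 2).Adelic → ℂ}, χ.IsUnitary → reflectChar (IsCMField.complexConj L) χ = χ →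
        IsChiSection χ φ → Continuous φ → ∀ {Cφ : ℝ}, (∀ x, ‖φ x‖ ≤ Cφ) →
        IsChiSection χ φ' → Continuous φ' → ∀ {Cφ' : ℝ}, (∀ x, ‖φ' x‖ ≤ Cφ') →
      ∀ {f f' : ℝ → ℂ}, ContDiff ℝ 2 f → HasCompactSupport f → tsupport f ⊆ Ioi 0 → ContDiff ℝ 2 f' → HasCompactSupport f' → tsupport f' ⊆ Ioi 0 →
      ∀ {σ₀ : ℝ}, 1 < σ₀ →
        Integrable (fun x : (quasiSplit (↥(maximalRealSubfield L)) L (IsCMField.complexConj L) 2).automorphicQuotient =>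
            (quasiSplit (↥(maximalRealSubfield L)) L (IsCMField.complexConj L) 2).quotFun (eisensteinSeriesU (fun g : (quasiSplit (↥(maximalRealSubfield L)) L (IsCMField.complexConj L) 2).Adelic => f (borelHeight g : ℝ) * φ g)) x * conj ((quasiSplit (↥(maximalRealSubfield L)) L (IsCMField.complexConj L) 2).quotFun (eisensteinSeriesU (fun g : (quasiSplit (↥(maximalRealSubfield L)) L (IsCMField.complexConj L) 2).Adelic => f' (borelHeight g : ℝ) * φ' g)) x)) μ ∧
        ∫ x, (quasiSplit (↥(maximalRealSubfield L)) L (IsCMField.complexConj L) 2).quotFun (eisensteinSeriesU (fun g : (quasiSplit (↥(maximalRealSubfield L)) L (IsCMField.complexConj L) 2).Adelic => f (borelHeight g : ℝ) * φ g)) x * conj ((quasiSplit (↥(maximalRealSubfield L)) L (IsCMField.complexConj L) 2).quotFun (eisensteinSeriesU (fun g : (quasiSplit (↥(maximalRealSubfield L)) L (IsCMField.complexConj L) 2).Adelic => f' (borelHeight g : ℝ) * φ' g)) x) ∂μ =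
          (C : ℂ) * (((((2 * π)⁻¹ : ℝ) : ℂ) * ∫ y : ℝ, mellin f (-((σ₀ : ℂ) + y * I)) * conj (mellin f' (conj ((σ₀ : ℂ) + y * I) - 1))) * ∫ k : ((standardMaximalCompactGL 2 L).comap (adelicVal (↥(maximalRealSubfield L)) L (IsCMField.complexConj L) 2 ((StdForm.antidiagonal 2).over L)) : Subgroup (quasiSplit (↥(maximalRealSubfield L)) L (IsCMField.complexConj L) 2).Adelic), φ (k : (quasiSplit (↥(maximalRealSubfield L)) L (IsCMField.complexConj L) 2).Adelic) * conj (φ' (k : (quasiSplit (↥(maximalRealSubfield L)) L (IsCMField.complexConj L) 2).Adelic)) ∂μK +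
            ((ν 𝓕).toReal⁻¹ : ℝ) • ∫ k : ((standardMaximalCompactGL 2 L).comap (adelicVal (↥(maximalRealSubfield L)) L (IsCMField.complexConj L) 2 ((StdForm.antidiagonal 2).over L)) : Subgroup (quasiSplit (↥(maximalRealSubfield L)) L (IsCMField.complexConj L) 2).Adelic), φ (k : (quasiSplit (↥(maximalRealSubfield L)) L (IsCMField.complexConj L) 2).Adelic) * ((((2 * π)⁻¹ : ℝ) : ℂ) * ∫ y : ℝ, mellin f (-((σ₀ : ℂ) + y * I)) * conj (mellin f' (-conj ((σ₀ : ℂ) + y * I))) * conj (∫ v : ↥(adelicUnipotent (↥(maximalRealSubfield L)) L (IsCMField.complexConj L) 2), flatSectionU φ' (conj ((σ₀ : ℂ) + y * I)) (((quasiSplit (↥(maximalRealSubfield L)) L (IsCMField.complexConj L) 2).toAdelic (weylLongU ((IsCMField.complexConj L : L ≃ₐ[↥(maximalRealSubfield L)] L) : L →+* L) (rfl : (StdForm.antidiagonal 2).over L = (StdForm.antidiagonal 2).over L))) * ((v : (quasiSplit (↥(maximalRealSubfield L)) L (IsCMField.complexConj L) 2).Adelic) * (k : (quasiSplit (↥(maximalRealSubfield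 L)) L (IsCMField.complexConj L) 2).Adelic))) ∂ν)) ∂μK) := by
  classical
  haveI := t2Space_adeleRing_of_numberField L
  haveI := locallyCompactSpace_adeleRing' L
  have hKc : IsCompact ((((standardMaximalCompactGL 2 L).comap (adelicVal (↥(maximalRealSubfield L)) L (IsCMField.complexConj L) 2 ((StdForm.antidiagonal 2).over L)) : Subgroup (quasiSplit (↥(maximalRealSubfield L)) L (IsCMField.complexConj L) 2).Adelic)) : Set (quasiSplit (↥(maximalRealSubfield L)) L (IsCMField.complexConj L) 2).Adelic) := isCompact_comap_adelicVal_standardMaximalCompactGL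
  haveI : CompactSpace ((standardMaximalCompactGL 2 L).comap (adelicVal (↥(maximalRealSubfield L)) L (IsCMField.complexConj L) 2 ((StdForm.antidiagonal 2).over L)) : Subgroup (quasiSplit (↥(maximalRealSubfield L)) L (IsCMField.complexConj L) 2).Adelic) := isCompact_iff_compactSpace.1 hKc
  haveI : IsFiniteMeasure μK := CompactSpace.isFiniteMeasure
  obtain ⟨C, hC, hH⟩ := chiPseudoEisenstein_inner_product_eq_sum_setIntegral_ideleClass_cm_two L μ νG μK νI h𝓕I ν h𝓕N h𝓕c h𝓕₀
  have hV0 : idelicCovolume L νI ≠ 0 := idelicCovolume_ne_zero νI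
  have hVt : idelicCovolume L νI ≠ ∞ := idelicCovolume_ne_top νI
  refine ⟨C * (idelicCovolume L νI).toReal, mul_pos hC (ENNReal.toReal_pos hV0 hVt), ?_⟩
  intro χ φ φ' hχu hsd hφ hφc Cφ hφC hφ' hφ'c Cφ' hφ'C f f' hf hfs hf0 hf' hf's hf'0 σ₀ hσ₀
  obtain ⟨-, -, hInt, hEq⟩ := hH hχu hχu hφ hφc hφC hφ' hφ'c hφ'C hf hfs hf0 hf' hf's hf'0 hσ₀
  refine ⟨hInt, ?_⟩
  -- `|χ|² = 1`: both character factors disappear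
  have hsq : ∀ x : (AdeleRing (𝓞 L) L)ˣ, ((χ x : ℂˣ) : ℂ) * conj ((χ x : ℂˣ) : ℂ) = 1 := fun x => by
    rw [mul_comm, ← Complex.normSq_eq_conj_mul_self, Complex.normSq_eq_norm_sq, hχu x]
    norm_num
  -- (1) the `w = 1` term: ★ C ∘ ★ A Parseval I
  have hI₁ : ∫ x in 𝓕I, (IdeleClassGroup.ideleNorm L x : ℝ)⁻¹ • ((((χ x : ℂˣ) : ℂ) * conj ((χ x : ℂˣ) : ℂ)) * ((f (IdeleClassGroup.ideleNorm L x : ℝ) * conj (f' (IdeleClassGroup.ideleNorm L x : ℝ))) * ∫ k : ((standardMaximalCompactGL 2 L).comap (adelicVal (↥(maximalRealSubfield L)) L (IsCMField.complexConj L) 2 ((StdForm.antidiagonal 2).over L)) : Subgroup (quasiSplit (↥(maximalRealSubfield L)) L (IsCMField.complexConj L) 2).Adelic), φ (k : (quasiSplit (↥(maximalRealSubfield L)) L (IsCMField.complexConj L) 2).Adelic) * conj (φ' (k : (quasiSplit (↥(maximalRealSubfield L)) L (IsCMField.complexConj L) 2).Adelic)) ∂μK)) ∂νI = ((idelicCovolume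 L νI).toReal : ℂ) * (((((2 * π)⁻¹ : ℝ) : ℂ) * ∫ y : ℝ, mellin f (-((σ₀ : ℂ) + y * I)) * conj (mellin f' (conj ((σ₀ : ℂ) + y * I) - 1))) * ∫ k : ((standardMaximalCompactGL 2 L).comap (adelicVal (↥(maximalRealSubfield L)) L (IsCMField.complexConj L) 2 ((StdForm.antidiagonal 2).over L)) : Subgroup (quasiSplit (↥(maximalRealSubfield L)) L (IsCMField.complexConj L) 2).Adelic), φ (k : (quasiSplit (↥(maximalRealSubfield L)) L (IsCMField.complexConj L) 2).Adelic) * conj (φ' (k : (quasiSplit (↥(maximalRealSubfield L)) L (IsCMField.complexConj L) 2).Adelic)) ∂μK) := by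
    simp_rw [hsq, one_mul]
    rw [setIntegral_inv_ideleNorm_smul_comp_eq νI h𝓕I (φ := fun r : ℝ => f r * conj (f' r) * ∫ k : ((standardMaximalCompactGL 2 L).comap (adelicVal (↥(maximalRealSubfield L)) L (IsCMField.complexConj L) 2 ((StdForm.antidiagonal 2).over L)) : Subgroup (quasiSplit (↥(maximalRealSubfield L)) L (IsCMField.complexConj L) 2).Adelic), φ (k : (quasiSplit (↥(maximalRealSubfield L)) L (IsCMField.complexConj L) 2).Adelic) * conj (φ' (k : (quasiSplit (↥(maximalRealSubfield L)) L (IsCMField.complexConj L) 2).Adelic)) ∂μK)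
      (((hf.continuous.mul (continuous_conj.comp hf'.continuous)).comp Real.continuous_exp).mul continuous_const).aestronglyMeasurable,
      Complex.real_smul, ← setIntegral_mul_conj_mul_cpow_eq hf hfs hf0 hf'.continuous hf's hf'0 σ₀, ← integral_mul_const]
    congr 1
    refine setIntegral_congr_fun measurableSet_Ioi fun r _ => ?_
    ring
  -- (2) the `w = w₀` term is radial (`χʷ = χ`): `G₂(x) = ‖x‖⁻¹ • φ₂(‖x‖)`; ★ C; §2
  set φ₂ : ℝ → ℂ := fun r => f r * ∫ k : ((standardMaximalCompactGL 2 L).comap (adelicVal (↥(maximalRealSubfield L)) L (IsCMField.complexConj L) 2 ((StdForm.antidiagonal 2).over L)) : Subgroup (quasiSplit (↥(maximalRealSubfield L)) L (IsCMField.complexConj L) 2).Adelic), φ (k : (quasiSplit (↥(maximalRealSubfield L)) L (IsCMField.complexConj L) 2).Adelic) * conj (((ν 𝓕).toReal⁻¹ : ℝ) • ((((2 * π)⁻¹ : ℝ) : ℂ) * ∫ y : ℝ, mellin f' (-((σ₀ : ℂ) + y * I)) * ((((r : ℝ) : ℂ) * (((r)⁻¹ : ℝ) : ℂ) ^ ((σ₀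 : ℂ) + y * I)) * ∫ v : ↥(adelicUnipotent (↥(maximalRealSubfield L)) L (IsCMField.complexConj L) 2), flatSectionU φ' ((σ₀ : ℂ) + y * I) (((quasiSplit (↥(maximalRealSubfield L)) L (IsCMField.complexConj L) 2).toAdelic (weylLongU ((IsCMField.complexConj L : L ≃ₐ[↥(maximalRealSubfield L)] L) : L →+* L) (rfl : (StdForm.antidiagonal 2).over L = (StdForm.antidiagonal 2).over L))) * ((v : (quasiSplit (↥(maximalRealSubfield L)) L (IsCMField.complexConj L) 2).Adelic) * (k : (quasiSplit (↥(maximalRealSubfield L)) L (IsCMField.complexConj L) 2).Adelic))) ∂ν))) ∂μK with hφ₂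
  have hG₂rad : ∀ x : (AdeleRing (𝓞 L) L)ˣ, (IdeleClassGroup.ideleNorm L x : ℝ)⁻¹ • ((((χ x : ℂˣ) : ℂ) * conj (((reflectChar (IsCMField.complexConj L) χ) x : ℂˣ) : ℂ)) * (f (IdeleClassGroup.ideleNorm L x : ℝ) * ∫ k : ((standardMaximalCompactGL 2 L).comap (adelicVal (↥(maximalRealSubfield L)) L (IsCMField.complexConj L) 2 ((StdForm.antidiagonal 2).over L)) : Subgroup (quasiSplit (↥(maximalRealSubfield L)) L (IsCMField.complexConj L) 2).Adelic), φ (k : (quasiSplit (↥(maximalRealSubfield L)) L (IsCMField.complexConj L) 2).Adelic) * conj (((ν 𝓕).toReal⁻¹ : ℝ) • ((((2 * π)⁻¹ : ℝ) : ℂ) * ∫ y : ℝ, mellin f' (-((σ₀ : ℂ) + y * I)) * (((((IdeleClassGroup.ideleNorm L x : ℝ≥0) : ℝ) : ℂ) * ((((IdeleClassGroup.ideleNorm L x)⁻¹ : ℝ≥0) : ℝ) : ℂ) ^ ((σ₀ : ℂ) + y * I)) * ∫ v : ↥(adelicUnipotent (↥(maximalRealSubfield L)) L (IsCMField.complexConj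 L) 2), flatSectionU φ' ((σ₀ : ℂ) + y * I) (((quasiSplit (↥(maximalRealSubfield L)) L (IsCMField.complexConj L) 2).toAdelic (weylLongU ((IsCMField.complexConj L : L ≃ₐ[↥(maximalRealSubfield L)] L) : L →+* L) (rfl : (StdForm.antidiagonal 2).over L = (StdForm.antidiagonal 2).over L))) * ((v : (quasiSplit (↥(maximalRealSubfield L)) L (IsCMField.complexConj L) 2).Adelic) * (k : (quasiSplit (↥(maximalRealSubfield L)) L (IsCMField.complexConj L) 2).Adelic))) ∂ν))) ∂μK)) = (IdeleClassGroup.ideleNorm L x : ℝ)⁻¹ • φ₂ (IdeleClassGroup.ideleNorm L x : ℝ) := fun x => by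
    simp only [hφ₂, hsd, hsq, one_mul, NNReal.coe_inv]
  have hφ₂m : Measurable φ₂ := hf.continuous.measurable.mul
    ((measurable_w0Integrand_cm_two L ν 𝓕 hφc hφ'c hf' hf's hf'0 σ₀).stronglyMeasurable.integral_prod_right' (ν := μK)).measurable
  have hI₂ : ∫ x in 𝓕I, (IdeleClassGroup.ideleNorm L x : ℝ)⁻¹ • ((((χ x : ℂˣ) : ℂ) * conj (((reflectChar (IsCMField.complexConj L) χ) x : ℂˣ) : ℂ)) * (f (IdeleClassGroup.ideleNorm L x : ℝ) * ∫ k : ((standardMaximalCompactGL 2 L).comap (adelicVal (↥(maximalRealSubfield L)) L (IsCMField.complexConj L) 2 ((StdForm.antidiagonal 2).over L)) : Subgroup (quasiSplit (↥(maximalRealSubfield L)) L (IsCMField.complexConj L) 2).Adelic), φ (k : (quasiSplit (↥(maximalRealSubfield L)) L (IsCMField.complexConj L) 2).Adelic) * conj (((ν 𝓕).toReal⁻¹ : ℝ) • ((((2 * π)⁻¹ : ℝ) : ℂ) * ∫ y : ℝ, mellin f' (-((σ₀ : ℂ) + y * I)) * (((((IdeleClassGroup.ideleNorm L x : ℝ≥0)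 : ℝ) : ℂ) * ((((IdeleClassGroup.ideleNorm L x)⁻¹ : ℝ≥0) : ℝ) : ℂ) ^ ((σ₀ : ℂ) + y * I)) * ∫ v : ↥(adelicUnipotent (↥(maximalRealSubfield L)) L (IsCMField.complexConj L) 2), flatSectionU φ' ((σ₀ : ℂ) + y * I) (((quasiSplit (↥(maximalRealSubfield L)) L (IsCMField.complexConj L) 2).toAdelic (weylLongU ((IsCMField.complexConj L : L ≃ₐ[↥(maximalRealSubfield L)] L) : L →+* L) (rfl : (StdForm.antidiagonal 2).over L = (StdForm.antidiagonal 2).over L))) * ((v : (quasiSplit (↥(maximalRealSubfield L)) L (IsCMField.complexConj L) 2).Adelic) * (k : (quasiSplit (↥(maximalRealSubfield L)) L (IsCMField.complexConj L) 2).Adelic))) ∂ν))) ∂μK)) ∂νI = ((idelicCovolume L νI).toReal : ℂ) * (((((ν 𝓕).toReal⁻¹ : ℝ)) : ℂ) * ∫ k : ((standardMaximalCompactGL 2 L).comap (adelicVal (↥(maximalRealSubfield L)) L (IsCMField.complexConj L) 2 ((StdForm.antidiagonal 2).over L)) : Subgroup (quasiSplit (↥(maximalRealSubfield L)) L (IsCMField.complexConj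 L) 2).Adelic), φ (k : (quasiSplit (↥(maximalRealSubfield L)) L (IsCMField.complexConj L) 2).Adelic) * ((((2 * π)⁻¹ : ℝ) : ℂ) * ∫ y : ℝ, mellin f (-((σ₀ : ℂ) + y * I)) * conj (mellin f' (-conj ((σ₀ : ℂ) + y * I))) * conj (∫ v : ↥(adelicUnipotent (↥(maximalRealSubfield L)) L (IsCMField.complexConj L) 2), flatSectionU φ' (conj ((σ₀ : ℂ) + y * I)) (((quasiSplit (↥(maximalRealSubfield L)) L (IsCMField.complexConj L) 2).toAdelic (weylLongU ((IsCMField.complexConj L : L ≃ₐ[↥(maximalRealSubfield L)] L) : L →+* L) (rfl : (StdForm.antidiagonal 2).over L = (StdForm.antidiagonal 2).over L))) * ((v : (quasiSplit (↥(maximalRealSubfield L)) L (IsCMField.complexConj L) 2).Adelic) * (k : (quasiSplit (↥(maximalRealSubfield L)) L (IsCMField.complexConj L) 2).Adelic))) ∂ν)) ∂μK) := by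
    rw [setIntegral_congr_fun h𝓕I.measurableSet (fun x _ => hG₂rad x), setIntegral_inv_ideleNorm_smul_comp_eq νI h𝓕I (φ := φ₂) (hφ₂m.comp Real.measurable_exp).aestronglyMeasurable,
      Complex.real_smul, ← setIntegral_w0_radial_eq_cm_two L ν h𝓕N h𝓕c μK hφc hφC hφ'c hφ'C hf hfs hf0 hf' hf's hf'0 hσ₀]
  rw [hEq, hI₁, hI₂]
  simp only [Complex.real_smul]
  push_cast
  ring

end Summit.HodgeConjecture.HodgeConjecture.Cruxes.H413.K2E1ChiPseudoEisensteinSelfDualCMTwo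

end
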